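import Mathlib.Analysis.SpecialFunctions.Pow.Real
import Mathlib.Data.ENNReal.Real
import Mathlib.Data.ENNReal.Operations

/-!
# Klainerman–Szeftel, *Kerr stability for small angular momentum*: the bootstrap architecture, typed

CITATION HEADER (lean-in-tree rule 2026-08-18). This module is a TYPED SKELETON of the bootstrap /
continuity argument of the published paper

* S. Klainerman, J. Szeftel, *Kerr stability for small angular momentum*, arXiv:2104.11857 (v1, 2021)
  = bib key `KlainermanSzeftel2021`; journal version Pure Appl. Math. Q. **19** (2023) no. 3, 791–1678 =
  bib key `KlainermanSzeftel2023` (refereed).  The text reproduced here is the arXiv e-print (the only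
  arXiv version; its TeX source `Main-Kerr-arxiv.tex` is the file whose line numbers `KS l.N` are quoted
  below).  JOURNAL CURRENCY (v2 of this module): every node was then re-read against the REFEREED
  version in the authors' accepted manuscript, HAL deposit hal-04280491 (dated July 14, 2023; its
  citation line names Pure Appl. Math. Q. 19 (3) (2023) 791–1678), cited below as `[J]` with locators
  `HAL hal-04280491 p. N Lm` = PDF page `N`, text line `m` of that deposit (`[J]` keeps the e-print's
  chapter.section.item numbering, e.g. `[J]` Theorem 9.4.15).  Outcome, node by node in the
  `[cite: KlainermanSzeftel2021, …; KlainermanSzeftel2023, …]` tags: the §3.4, §3.5, §3.7, §3.8 displays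
  typed here are VERBATIM UNCHANGED in `[J]` except (i) (3.4.1), `min{m0, 1}` → `min{m0 − |a0|, 1}`
  (shadow `Constants.DeltaGapJ`); (ii) Theorem M1 — the carrier and weights of its displayed
  functionals changed (same logical shape; see `ThmM1`); (iii) Theorem M2 — its first clause
  `^(int)𝔇_{k_small+80}[α̲] + ^(top)𝔇_{k_small+80}[α̲] ≲ ε0` is DELETED in `[J]` (journal shape `ThmM2J`,
  edge `ThmM3fromM1M2J`, both implied by the v1 shapes).  In ch. 9, `[J]` §9.4.4 adds a sentence
  declaring BA-PT a notational device for the standard error estimate (9.4.20) (see `BA_PT`,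
  `BAPTonExtension`: the typed node is unchanged, its status in print is re-described), Lemma 9.4.13
  gains the display (9.4.24), Theorem 9.4.15 is stated in the GKS form, the items after it are
  renumbered by −1 (Props 9.4.16–9.4.19, Cor. 9.4.20, Lemma 9.4.21) and Lemma 9.4.21 gains `ε0`
  summands; ch. 8's proof of Theorem M7 is `[J]` §8.5 (e-print §8.9), the same 18 steps.  v2 also adds
  the M7-restricted forms `Lemma9413`/`IterBaseOfLow`, `IterStepM7`, `IterTopM7` of the ch.-9 nodes
  (both versions state §9.4.7–9.4.8 for the spacetime of Theorem M7: proof of Lemma 9.4.13, `[J]` HAL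
  p. 624 L30 = TeX l.24363) and `mainTheorem_of_leaves_J`, the leaf-resolution certificate from the
  JOURNAL shapes (26 hypotheses).  ADDITIVE ONLY: no v1 declaration was renamed or retyped (the cell's
  `Dag`, `Bridge`, `BridgeDag`, `IterationStep`, `IterationClosure`, `MixedRateCount`, `JunctionLevels`
  import this file).  Glyph: KS's macro `\Sk` is `\mathfrak{G}`; the `𝔖_k` of the ch.-9 docstrings
  below and the `𝔊_k` of `[J]`'s text layer are the same norm.
* Companion texts named in docstrings (never used as facts): E. Giorgi, S. Klainerman, J. Szeftel,
  arXiv:2205.14808 (2022; bib key `GiorgiKlainermanSzeftel2022`) = "GKS"; S. Klainerman, J. Szeftel,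
  arXiv:1711.07597 = Ann. Math. Studies 210 (2020; bib key `KlainermanSzeftel2020`) = "KS-Schw";
  D. Shen, arXiv:2205.12336 = Ann. PDE 9 (2023; bib key `Shen2023GCM`); the GCM papers
  arXiv:1911.00697, arXiv:1912.12195.

WHAT IS REPRODUCED, and in what sense.  KS chapter 3 (§3.4 the main theorem and its smallness constants,
§3.5 the bootstrap assumptions **BA-B**, **BA-D**, §3.7.1 the intermediate Theorems M0–M8, §3.7.2 the
continuity argument, §3.8 the passage to the limit), chapter 8 §8.9 (the 18-step plan of Theorem M7)
and chapter 9 §9.4 (Theorem M8 via the Main PT-Theorem 9.4.10 and its inner bootstrap **BA-PT**) are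
typed at STATEMENT LEVEL over an abstract carrier `Setting` (a structure of opaque data: the type of GCM
admissible spacetimes, `u_*`, `r_*`, `(m, a)`, the eight regional norms of KS §3.3 as `ℕ → ℝ`, the
initial-data-layer norms, and opaque functionals for the displayed left-hand sides of Theorems M0, M1, M2,
for the PT norms of ch. 9 and for the limiting spacetime).  Every displayed statement of the paper becomes
a `def … : Prop` over `(K : LesConstants) (S : Setting c)` — a STATEMENT SHAPE, i.e. a hypothesis node:
for a given instance `S` it is DATA to be supplied as a hypothesis `(h : ThmM3 K S)`, never asserted.
NAMED-FACT SEMANTICS DO NOT APPLY: over an arbitrary `Setting` none of these Props is a theorem (the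
carrier is unconstrained), so no `_holds` discharge is expected; the `[cite: …]` tags below record the
PROVENANCE of each shape (which display of the paper it transcribes, with the TeX line), not a claim.
What IS proved here (zero `sorry`, axioms ⊆ {propext, Classical.choice, Quot.sound}) is the LOGIC of
KS §3.7.2 and of the proof plans of Theorems M7/M8: `improvedDecay_of_M3_M4_M5` ((3.7.1)),
`extension_mem_U`, `Uset_not_bddAbove` (the continuity argument), `mainTheorem_of_nodes`,
`mainTheorem_of_leaves` (Main Theorem, version 2, from 25 explicit hypotheses), `thmM7_of_ch8`,
`thmM8_of_ch9`, `mainPT_of_subnodes`, `iter_to_top` (the J-induction of §9.4.8), and the only numeric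
the argument consumes, `eps_arith` (`C ε₀ ≤ ε₀^{2/3}` once `ε₀ ≤ C⁻³`); v2 adds `thmM2J_of_thmM2`,
`thmM3fromM1M2_of_J`, `thmM3_of_M1_M2J`, `iterBase_of_lemma9413`, `iterStepM7_of_iterStep`,
`iterTopM7_of_iterTop`, `mainPT_of_subnodesJ`, `mainTheorem_of_leaves_J` (section `Journal`).

STATUS OF THE SOURCE.  KS is a refereed publication; this module neither re-proves nor disputes any of
its analytic estimates.  It was written by the audit cell `pub-kerr` (Final State Conjecture near-miss
cell 6: typed skeleton + `|a| ≪ M` census of the Klainerman–Szeftel / Giorgi–Klainerman–Szeftel proof),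
whose rule is that the manuscripts under audit enter only as explicit hypotheses.  Three steps that the
text ASSERTS WITHOUT PROOF are isolated as their own hypothesis nodes, so that the kernel certifies they
are exactly what the printed argument consumes: `FlowClosed` (KS l.6784–6785 "by the continuity of the
flow, U_* ∈ 𝒰"), `LimitExists` (KS §3.8 l.6832–6851, Main Theorem item 2: the limit `u_* → +∞`),
`BAPTonExtension` (KS l.24313–24319: the bootstrap assumption BA-PT of ch. 9 is introduced "to prove
Theorem 9.4.10" and is nowhere initiated or closed in print).  See the cell's BOOTSTRAP.md §6 / GAPS.md
block b2b-kerr-f3 for the word-by-word record; DIVERGENCE.md block b2b-kerr-f3 for every typing choice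
(ℵ(u_*) ≡ 𝒰(u_*); Definition 3.7.1 read with its footnote; `≪` relations untyped).

RELATION TO EXISTING TREE MATERIAL (reviewers please note).  `Literature.Geometry.Lorentzian.
klainerman_szeftel_kerr_stability_small_a_cauchy` (`StabilityCauchy.lean`, [KlainermanSzeftel2023,
Thm 1.2.1]) is the paper's END-STATEMENT as a named fact over `InitialDataSet` / `VacuumCauchyDevelopment`;
`SubextremalKerrStabilityConjecture` (`Stability.lean`) is the summit-side conjecture.  This module types
the INTERNAL ARCHITECTURE of the printed proof over an abstract bookkeeping carrier and claims NO relation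
to either: `MainTheoremV2 K S` is not a restatement of the named fact (different carrier, no metric, no
Cauchy development), and a bridge between the two typings would be a new, unproved item that is not part
of this reproduction.  Nothing here is Final-State-Conjecture progress.

STAGING.  The declarations of the cell's staged module `KerrSkeleton/Bootstrap.lean` v1.1 (namespace
`KerrSkeleton.Bootstrap`, md5 dd6815e4…, clean-built in the staging package 2026-08-18), code unchanged
except: the namespace moved under the path, provenance tags added, and the parameters `(K : LesConstants)
(S : Setting c) [(O : M7Objects S)]` of the 30 statement shapes written as explicit binders instead of
section variables (same elaborated constants) — so that each shape reads as what it is, a PREDICATE on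
settings, not a closed named fact (there is no `ThmM3_holds` to discharge; D-0026 debt accounting does not
apply).  The cell's `Dag.lean` (carver), `Bridge.lean` (foundations 1) and `Nodes/EM8Dag.lean`
(foundations 2) import it and are proposed after it.
Printed numbers (Definition 3.7.1, Theorem 9.4.10, (3.4.7), …) are reconstructed from the TeX counters of
the e-print; the TeX label + line is authoritative.

## Contents

* `Constants`, `Constants.Admissible` — the smallness constants of KS §3.4.1 (l.6054–6111) with the
  *exact* (order) part of (3.4.1)–(3.4.4); the `≪` relations are not typed (docstrings only).
* `Setting` — the abstract carrier; `LesConstants` — one explicit universal constant per `≲`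
  (KS l.6115–6117).
* Hypothesis nodes (all `def … : Prop`, none proved, none assumed): `ThmM0 … ThmM8`, the chapter-9
  sub-nodes of M8 (`BA_PT`, `MainPT`, `ThmM0PT`, `IterBase`, `IterStep`, `IterTop`, `M8ofPT`,
  `BAPTonExtension`), the chapter-8 sub-nodes of M7, and `FlowClosed`, `LimitExists`, `ThmConclusions`;
  v2 (section `Journal`): the journal shapes `ThmM2J`, `ThmM3fromM1M2J`, the M7-restricted ch.-9 nodes
  `Lemma9413`, `IterBaseOfLow`, `IterStepM7`, `IterTopM7`, and the unconsumed shadow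
  `Constants.DeltaGapJ` of `[J]` (3.4.1).
* PROVED bookkeeping (pure logic + real arithmetic): `eps_arith`, `improvedDecay_of_M3_M4_M5`,
  `extension_mem_U`, `iter_to_top`, `mainPT_of_subnodes`, `thmM8_of_ch9`, `thmM7_of_ch8`,
  `param_bookkeeping`, `Uset_not_bddAbove`, `mainEstimate_of_nodes`, `mainTheorem_of_nodes`,
  `mainTheorem_of_leaves`; v2: `thmM2J_of_thmM2`, `thmM3fromM1M2_of_J`, `thmM3_of_M1_M2J`,
  `iterBase_of_lemma9413`, `iterStepM7_of_iterStep`, `iterTopM7_of_iterTop`, `mainPT_of_subnodesJ`,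
  `mainTheorem_of_leaves_J`.
* `trunc` and its lemmas — the `ℝ≥0∞ → ℝ` reading used by the cell's `Bridge.lean` to instantiate `Setting`
  from `ℝ≥0∞`-valued norms (generic, folklore).

Naming: KS writes the bootstrap family both as `𝒰(u_*)` (Definition 3.7.1, l.6744) and as `ℵ(u_*)`
(l.6785, 6789, 6792, 6808, 21617; `ℵ` is the notation of KS-Schw and is never defined in KS).  They are
ONE set; here `InU u X`.

What is deliberately NOT here: any metric, frame, curvature component or PDE (the analytic content of
Theorems M0–M8 lives in KS ch. 4–9 and GKS and is not formalised); the `≪` hierarchy of §3.4.1 beyond its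
strict-inequality shadows; "`|a_0|/m_0` sufficiently small" (the subject of the cell's census ADEP.md —
offered only as the unconsumed predicate `Constants.SmallA`); the KS ↔ GKS restatements of Theorems
M1, M2, 9.4.15 (separate nodes of the cell's `Dag.lean`).
-/

noncomputable section

namespace Literature.Geometry.Lorentzian.KlainermanSzeftel2021.Bootstrap

/-! ## §3.4.1 Smallness constants (KS l.6050–6117) -/

/-- The constants of KS §3.4.1, l.6054–6073: `m0 > 0`, `|a0| < m0` mass and angular momentum of
the reference Kerr; `klarge` = maximum number of derivatives; `ε0` = size of the initial data layer
norm; `ε` = size of the bootstrap norms; `r0` defines `𝒯 = {r = r0}`; `δH` (redshift region width),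
`δdec` (decay rates in `u`, `u̲`), `δB` (r-power in sup estimates of high derivatives of α, β),
`δstar` (behaviour of `r` on `S_*`, (3.4.5) l.6102–6105: `r_* = δ_* ε0⁻¹ u_*^{1+δdec}`).
`[J]` §3.4.1 (HAL hal-04280491 p. 139 L9 – p. 140 L6) lists the same ten constants with the same roles;
(3.4.5) is p. 140 L27–31, verbatim the same.
[cite: KlainermanSzeftel2021, §3.4.1 smallness constants, TeX l.6054–6073; KlainermanSzeftel2023, §3.4.1, HAL hal-04280491 p. 139 L9 – p. 140 L6 (= e-print)] -/
structure Constants where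
  m0 : ℝ
  a0 : ℝ
  klarge : ℕ
  ε0 : ℝ
  ε : ℝ
  r0 : ℝ
  δH : ℝ
  δdec : ℝ
  δB : ℝ
  δstar : ℝ

namespace Constants

/-- KS (3.4.6), l.6109–6111: `k_small = ⌊k_large / 2⌋ + 1` (natural-number division is the floor).
`[J]` (3.4.6), HAL hal-04280491 p. 140 L32–38: verbatim the same.
[cite: KlainermanSzeftel2021, eq. (3.4.6), TeX l.6109–6111; KlainermanSzeftel2023, eq. (3.4.6), HAL hal-04280491 p. 140 L32–38 (= e-print)] -/
def ksmall (c : Constants) : ℕ := c.klarge / 2 + 1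

/-- The EXACT part of the constraints (3.4.1)–(3.4.4), KS l.6075–6092.  The relations written
with `≪` / `≫` in KS ("0 < δH, δdec, δB, δ_* ≪ min{m0,1}", "r0 ≫ max{m0,1}", "klarge ≫ 1/δdec",
"0 < ε0, ε ≪ min{δH, δdec, δB, δ_*, 1/r0, 1/klarge, m0 − |a0|, 1}", "ε0, ε ≪ |a0| if a0 ≠ 0")
have no typed meaning; we record only their strict-inequality shadows, plus the one exact
relation `ε = ε0^{2/3}` (KS (3.4.4), l.6090–6091).  "|a0|/m0 sufficiently small" (Main Theorem,
l.6209) is likewise NOT typed here.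
JOURNAL: `[J]` (3.4.1)–(3.4.4), HAL hal-04280491 p. 140 L2–22, are verbatim the same EXCEPT the first
constraint of (3.4.1), which reads in `[J]` (p. 140 L3) "`0 < δH, δdec, δB, δ_* ≪ min{m0 − |a0|, 1}`,
`δB > 2δdec`" (e-print l.6077: `min{m0, 1}`).  The exact part recorded by this structure is unaffected
(`≪` is untyped); the refereed `min` is offered as the separate, unconsumed shadow `Constants.DeltaGapJ`
— no field is added here (the importing modules construct this structure).  `[J]` Remark 3.4.1
(p. 140 L23–26) = the e-print's unnumbered remark l.6094–6100.
[cite: KlainermanSzeftel2021, eq. (3.4.1)–(3.4.4), TeX l.6075–6092; KlainermanSzeftel2023, eq. (3.4.1)–(3.4.4), HAL hal-04280491 p. 140 L2–22 (Δ in (3.4.1) only: min{m0 − |a0|, 1})] -/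
structure Admissible (c : Constants) : Prop where
  m0_pos : 0 < c.m0
  abs_a0_lt : |c.a0| < c.m0
  δH_pos : 0 < c.δH
  δdec_pos : 0 < c.δdec
  δB_pos : 0 < c.δB
  δstar_pos : 0 < c.δstar
  /-- KS l.6078: `δB > 2 δdec`. -/
  two_δdec_lt_δB : 2 * c.δdec < c.δB
  /-- shadow of `r0 ≫ max{m0, 1}` (l.6079). -/
  r0_large : max c.m0 1 < c.r0
  /-- shadow of `klarge ≫ 1/δdec` (l.6079). -/
  klarge_large : 1 / c.δdec < (c.klarge : ℝ)
  ε0_pos : 0 < c.ε0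
  /-- shadow of `ε ≪ min{…, 1}` (l.6084): in particular `ε < 1`. -/
  ε_lt_one : c.ε < 1
  /-- shadow of `ε ≪ m0 − |a0|` (l.6084). -/
  ε_lt_gap : c.ε < c.m0 - |c.a0|
  /-- KS (3.4.4), l.6090–6091: `ε = ε0^{2/3}`. -/
  ε_eq : c.ε = c.ε0 ^ ((2 : ℝ) / 3)

end Constants

/-! ### The only numeric in the continuity argument: `ε = ε0^{2/3}` beats every `C ε0`. -/

/-- If `ε = ε0^{2/3}`, `0 < ε0` and `ε0 ≤ C⁻³` (this is what "ε0 sufficiently small, depending on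
the universal constant C" means in KS §3.7.2), then `C ε0 ≤ ε0^{2/3}`.  Used to turn every improved
bound `≲ ε0` into the bootstrap bound `≤ ε`.  Elementary real arithmetic. [folklore] -/
theorem eps_arith (C ε0 : ℝ) (hC : 0 < C) (h0 : 0 < ε0) (hsmall : ε0 ≤ (C⁻¹) ^ (3 : ℕ)) :
    C * ε0 ≤ ε0 ^ ((2 : ℝ) / 3) := by
  have h13 : ε0 ^ ((1 : ℝ) / 3) ≤ C⁻¹ := by
    have hC3 : ((C⁻¹) ^ (3 : ℕ)) ^ ((1 : ℝ) / 3) = C⁻¹ := by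
      rw [← Real.rpow_natCast, ← Real.rpow_mul (by positivity)]
      norm_num
    calc ε0 ^ ((1 : ℝ) / 3) ≤ ((C⁻¹) ^ (3 : ℕ)) ^ ((1 : ℝ) / 3) :=
          Real.rpow_le_rpow h0.le hsmall (by norm_num)
      _ = C⁻¹ := hC3
  have hsplit : ε0 = ε0 ^ ((1 : ℝ) / 3) * ε0 ^ ((2 : ℝ) / 3) := by
    rw [← Real.rpow_add h0]; norm_num
  have h23pos : 0 < ε0 ^ ((2 : ℝ) / 3) := Real.rpow_pos_of_pos h0 _
  calc C * ε0 = (C * ε0 ^ ((1 : ℝ) / 3)) * ε0 ^ ((2 : ℝ) / 3) := by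
        conv_lhs => rw [hsplit]
        ring
    _ ≤ (C * C⁻¹) * ε0 ^ ((2 : ℝ) / 3) := by gcongr
    _ = ε0 ^ ((2 : ℝ) / 3) := by rw [mul_inv_cancel₀ hC.ne']; ring

/-- The slow-rotation predicate `|a0| ≤ η·m0` offered as a separate explicit hypothesis (consumed by
nothing in this file).  Context (a census finding of the audit cell, NOT a statement of KS): the
small-`|a|` proof chain of GKS arXiv:2205.14808 Remark 13.6.4 needs `a0` chosen AFTER `r0`,
`|a0| ≤ η·m0` with `η = η(m0, r0, δ_B, k_large, …)`, whereas KS (3.4.1)–(3.4.4) fix `(m0, a0)`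
first (l.6056–6060, l.6075) and only ask "`|a0|/m0` sufficiently small" (l.6209). [folklore] -/
def Constants.SmallA (c : Constants) (η : ℝ) : Prop := |c.a0| ≤ η * c.m0

/-- With `0 < ε0 < 1`: `ε0 < ε0^{2/3}` (so an `O(ε0)` bound improves an `≤ ε` one when
`ε = ε0^{2/3}`).  Elementary. [folklore] -/
theorem eps0_lt_eps (ε0 : ℝ) (h0 : 0 < ε0) (h1 : ε0 < 1) : ε0 < ε0 ^ ((2 : ℝ) / 3) := by
  have : ε0 ^ (1 : ℝ) < ε0 ^ ((2 : ℝ) / 3) :=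
    Real.rpow_lt_rpow_of_exponent_gt h0 h1 (by norm_num)
  simpa using this

/-- With `0 < ε0 < 1`: `ε0 ^ 2 ≤ ε0` (so the Main-Theorem data bound (3.4.7) `𝓘 ≤ ε0²` implies
Theorem M0's displayed hypothesis `𝓘 ≤ ε0`, KS l.6212 vs l.6652).  Elementary. [folklore] -/
theorem eps0_sq_le (ε0 : ℝ) (h0 : 0 < ε0) (h1 : ε0 < 1) : ε0 ^ 2 ≤ ε0 := by
  nlinarith

/-! ## The abstract setting (instantiated by the cell's `Setup` / `Bridge` modules) -/

/-- Everything the continuity argument quantifies over, as opaque data.  Field ↦ KS object: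
* `M` — GCM admissible spacetimes `ℳ = ℳ^(ext) ∪ ℳ^(int) ∪ ℳ^(top)` (KS §3.2, l.5213ff) which are
  future developments of the FIXED admissible initial data layer `𝓛0(a0, m0)` (Def. 3.4.2,
  l.6133–6143; Def. 3.4.4, l.6156–6159);
* `ustar X`, `rstar X` — the values of `u` and `r` on the last sphere `S_*` of `Σ_*` (l.6107, 6748);
* `mass X`, `angm X` — the constants `(m, a)` of `X`, i.e. those of `S_*` (KS §3.2.4, l.5453–5467;
  footnote l.6350–6351: the norms are defined w.r.t. linearized quantities involving `(a, m)`);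
* `starB extB intB topB X k` — `^*𝔅_k`, `^(ext)𝔅_k`, `^(int)𝔅_k`, `^(top)𝔅_k` and
  `starD extD intD topD X k` — `^*𝔇_k`, `^(ext)𝔇_k`, `^(int)𝔇_k`, `^(top)𝔇_k` (KS §3.3.1–3.3.4,
  l.5636–5988); they are sup-norms over `𝔡^{≤ k}` derivatives, hence `Monotone` in `k` and `≥ 0`
  (the only two properties of the norms this file uses);
* `idl k` — the initial data layer norm `𝓘_k` of `𝓛0` (KS §3.3.6, l.6002–6041), `idlExt3` —
  `^(ext)𝓘_3` (l.6329);
* `m0Ext X`, `m0Int X` — the left-hand sides of the first two displays of Theorem M0 (sup over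
  `𝓑_1`, resp. `𝓑̲_1`, `0 ≤ k ≤ k_large − 2`, l.6655–6662);
* `m1Sup X δ`, `m1Flux X δ`, `m1A X δ` — the three left-hand sides of Theorem M1 with
  `δ_extra = δ` (l.6674–6687); `m2Dec X`, `m2Flux X` — the two left-hand sides of Theorem M2
  (l.6694–6696);
* `Extends X X'` — "`X'` is a GCM admissible extension of `X`" (Theorem M7, l.6796; intro
  l.1582–1598);
* `BuiltByM7 X X'` — "`X'` is THE spacetime exhibited (constructed) in the proof of Theorem M7
  from `X`" (KS §8.9, l.21594–23053); Theorem M8 (l.6804) speaks of "the GCM admissible spacetime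
  exhibited in Theorem M7", so its typed form quantifies only over such `X'`
  (instantiate with `fun _ _ => True` for the reading "every extension with the listed bounds");
* `ptNorm X k` — `𝔖_k + ℜ_k`, the global PT-frame norms of KS §9.4.1 (l.23855–24042: `L²`-based Ricci
  and curvature norms); `idlPT X k` — `𝓘^PT_k` (l.24040); `iter X J` — the iteration assumption
  `𝔖_J + ℜ_J ≲ ε0 + L_*(J)` (l.24447–24450);
* `Minf` — admissible future null complete spacetimes (Def. 3.4.5, l.6168–6187) developing `𝓛0`;
  `nSupInf Y a m`, `nDecInf Y a m` — `𝔑^(Sup)_{k_large}(a, m)`, `𝔑^(Dec)_{k_small}(a, m)` of `Y`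
  (Def. 3.4.6, l.6191–6194); `IsLimitOfU Y` — "`Y` is a limit of the GCM family `𝒰(u_*)`" (Main
  Theorem item 2, l.6223 + footnote); `Conclusions Y a m` — items 1–4 of the Main Theorem (Bondi mass,
  quasi-local angular momentum, coordinates on `ℳ^(ext)`, `ℳ^(int)`; l.6251–6317), proved in §3.8.
A bookkeeping carrier: no metric, frame or equation is modelled.
JOURNAL READING of the opaque functionals (v2).  `[J]` Definitions 3.4.2, 3.4.4, 3.4.5, 3.4.6 (HAL
hal-04280491 p. 141 L6 – p. 142 L17), Definition 3.7.1 with its footnote 32 and Definition 3.7.2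
(p. 158 L31 – p. 159 L7), the norms of §3.3 and (3.4.7)–(3.4.8) (p. 143 L2–24) are verbatim the
e-print's, so every field keeps its meaning — EXCEPT the Theorem-M1/M2 functionals: in `[J]` Theorem M1
(p. 157 L52–106) the weighted sup of item 1, `(r u^{1/2+δ} + u^{1+δ})|𝔡^k𝔮| + r u^{1+δ}|𝔡^{k−1}∇₃𝔮|`, is
taken over `Σ_*` ONLY, "with respect to the global frame of Proposition 3.6.9" (e-print l.6674–6679: the
same quantity over `ℳ^(ext)`, plus `sup_{ℳ^(int)∪ℳ^(top)} u̲^{1+δ}|𝔡^k𝔮|`); the flux display is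
unchanged; and item 2 reads `sup_{ℳ^(ext)}(r²u^{1+δ} + r³(2r+u)^{1/2+δ})|𝔡^kA| + sup_{ℳ^(ext)}(r³u^{1+δ} +
r⁴u^{1/2+δ} + r^{9/2+δdec})|𝔡^{k−1}∇₃A| + sup_{ℳ^(ext)}(r⁴u^{1+δ} + r^{9/2+δdec})|𝔡^{k−2}∇₃²A| + sup_{ℳ^(int)}
r²u^{1+δ}|𝔡^kA| ≲ ε0` (e-print l.6684–6686: `sup_{ℳ^(ext)}(r²(2r+u)^{1+δ}/log(1+u) +
r³(2r+u)^{1/2+δ})(|𝔡^kA| + r|𝔡^{k−1}∇₃A|) ≲ ε0`; the deposit's text layer does not render under-bars, so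
`u` vs `u̲` on `ℳ^(int)` is not distinguished in these transcriptions): `m1Sup`, `m1Flux`, `m1A` denote the
left-hand sides of WHICHEVER version the instance transcribes — the logical shape of `ThmM1` is the same
for both.
`[J]` Theorem M2 (p. 158 L2–9) keeps only the `Σ_*`-flux, so `m2Dec` has no counterpart INSIDE the
journal's Theorem M2 (its content, `sup_{ℳ^(int)} u̲^{1+δdec}|𝔡^{≤k_small+33}A̲| ≲ ε0` etc., is PROVED
in `[J]` ch. 7, Propositions 7.3.1 and 7.6.1, HAL p. 427 L17–21 and p. 447, inside the proof of Theorem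
M5); see `ThmM2J`.
[cite: KlainermanSzeftel2021, §3.2–3.4 and §3.7 (the objects quantified over), TeX l.5213–6851; KlainermanSzeftel2023, §3.3–3.4 and §3.7, HAL hal-04280491 p. 141–143 and p. 156–159 (= e-print except Theorems M1/M2, see text)] -/
structure Setting (c : Constants) where
  M : Type
  ustar : M → ℝ
  rstar : M → ℝ
  mass : M → ℝ
  angm : M → ℝ
  starB : M → ℕ → ℝ
  extB : M → ℕ → ℝ
  intB : M → ℕ → ℝ
  topB : M → ℕ → ℝ
  starD : M → ℕ → ℝ
  extD : M → ℕ → ℝ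
  intD : M → ℕ → ℝ
  topD : M → ℕ → ℝ
  starB_mono : ∀ X, Monotone (starB X)
  extB_mono : ∀ X, Monotone (extB X)
  intB_mono : ∀ X, Monotone (intB X)
  topB_mono : ∀ X, Monotone (topB X)
  starD_mono : ∀ X, Monotone (starD X)
  extD_mono : ∀ X, Monotone (extD X)
  intD_mono : ∀ X, Monotone (intD X)
  topD_mono : ∀ X, Monotone (topD X)
  starB_nonneg : ∀ X k, 0 ≤ starB X k
  extB_nonneg : ∀ X k, 0 ≤ extB X k
  intB_nonneg : ∀ X k, 0 ≤ intB X k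
  topB_nonneg : ∀ X k, 0 ≤ topB X k
  starD_nonneg : ∀ X k, 0 ≤ starD X k
  extD_nonneg : ∀ X k, 0 ≤ extD X k
  intD_nonneg : ∀ X k, 0 ≤ intD X k
  topD_nonneg : ∀ X k, 0 ≤ topD X k
  idl : ℕ → ℝ
  idlExt3 : ℝ
  m0Ext : M → ℝ
  m0Int : M → ℝ
  m1Sup : M → ℝ → ℝ
  m1Flux : M → ℝ → ℝ
  m1A : M → ℝ → ℝ
  m2Dec : M → ℝ
  m2Flux : M → ℝ
  Extends : M → M → Prop
  BuiltByM7 : M → M → Prop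
  ptNorm : M → ℕ → ℝ
  idlPT : M → ℕ → ℝ
  iter : M → ℕ → Prop
  Minf : Type
  nSupInf : Minf → ℝ → ℝ → ℝ
  nDecInf : Minf → ℝ → ℝ → ℝ
  IsLimitOfU : Minf → Prop
  Conclusions : Minf → ℝ → ℝ → Prop

/-- One explicit universal constant per `≲` sign (KS l.6115–6117: "`≲` means bounded by a
constant depending only on geometric universal constants … as well as `m0, a0, δH, δdec, δB, δ_*,
r0, klarge` but NOT on `ε` and `ε0`").  `cM0 … cM8` are the constants of Theorems M0–M8, `cPT` of
the Main PT-Theorem 9.4.10, `cMain` the `C` of (3.4.8) (l.6219–6221).  Every `≲ ε0` of the paper is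
typed as `≤ c_i * ε0` with `c_i` a field of this record.  `[J]` states the convention verbatim the
same (HAL hal-04280491 p. 140 L39–43).  In v2, `cPT` also serves `[J]` Lemma 9.4.13 (9.4.23)
(`Lemma9413`) — one record field per `≲` would want a `cPT'`; since only the logical shape is certified,
the Main-PT constant is reused (take `cPT` := the max of the two).
[cite: KlainermanSzeftel2021, §3.4.1 the ≲-convention, TeX l.6115–6117; KlainermanSzeftel2023, §3.4.1, HAL hal-04280491 p. 140 L39–43 (= e-print)] -/
structure LesConstants where
  cM0 : ℝ
  cM1 : ℝ
  cM2 : ℝ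
  cM3 : ℝ
  cM4 : ℝ
  cM5 : ℝ
  cM7 : ℝ
  cM8 : ℝ
  cPT : ℝ
  cMain : ℝ

namespace LesConstants

/-- The constant of the improved decay bound (3.7.1) `𝔑^(Dec)_{k_small+20} ≲ ε0` obtained by
adding Theorems M3, M4, M5 (see `improvedDecay_of_M3_M4_M5`).
[cite: KlainermanSzeftel2021, eq. (3.7.1), TeX l.6726–6729] -/
def cDec (K : LesConstants) : ℝ := K.cM3 + K.cM4 + K.cM5

end LesConstants

variable {c : Constants}

/-! ## §3.3.5 Combined norms and §3.5 bootstrap assumptions -/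

section Norms
variable (S : Setting c)

/-- KS (l.5995): `𝔑^(Sup)_k := ^*𝔅_k + ^(ext)𝔅_k + ^(int)𝔅_k + ^(top)𝔅_k`.
[cite: KlainermanSzeftel2021, §3.3.5 combined norms, TeX l.5995] -/
def NSup (X : S.M) (k : ℕ) : ℝ := S.starB X k + S.extB X k + S.intB X k + S.topB X k

/-- KS (l.5996): `𝔑^(Dec)_k := ^*𝔇_k + ^(ext)𝔇_k + ^(int)𝔇_k + ^(top)𝔇_k`.
[cite: KlainermanSzeftel2021, §3.3.5 combined norms, TeX l.5996] -/
def NDec (X : S.M) (k : ℕ) : ℝ := S.starD X k + S.extD X k + S.intD X k + S.topD X k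

/-- `𝔑^(Sup)_k` is nondecreasing in `k` (sum of four nondecreasing functions). [folklore] -/
theorem NSup_mono (X : S.M) : Monotone (NSup S X) := fun _ _ h =>
  add_le_add (add_le_add (add_le_add (S.starB_mono X h) (S.extB_mono X h)) (S.intB_mono X h))
    (S.topB_mono X h)

/-- `𝔑^(Dec)_k` is nondecreasing in `k`. [folklore] -/
theorem NDec_mono (X : S.M) : Monotone (NDec S X) := fun _ _ h =>
  add_le_add (add_le_add (add_le_add (S.starD_mono X h) (S.extD_mono X h)) (S.intD_mono X h))
    (S.topD_mono X h)

/-- `𝔑^(Sup)_k ≥ 0`. [folklore] -/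
theorem NSup_nonneg (X : S.M) (k : ℕ) : 0 ≤ NSup S X k :=
  add_nonneg (add_nonneg (add_nonneg (S.starB_nonneg X k) (S.extB_nonneg X k))
    (S.intB_nonneg X k)) (S.topB_nonneg X k)

/-- `𝔑^(Dec)_k ≥ 0`. [folklore] -/
theorem NDec_nonneg (X : S.M) (k : ℕ) : 0 ≤ NDec S X k :=
  add_nonneg (add_nonneg (add_nonneg (S.starD_nonneg X k) (S.extD_nonneg X k))
    (S.intD_nonneg X k)) (S.topD_nonneg X k)

/-- **BA-B** (Bootstrap Assumptions on r-weighted sup norms), KS (3.5.1) l.6353–6356, verbatim: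
`𝔑^(Sup)_{k_large} + |m − m0| + |a − a0| ≤ ε`.  `[J]` (3.5.1), HAL hal-04280491 p. 146 L24–26: verbatim
the same (with footnote 21, L31–32 = e-print l.6350–6351).
[cite: KlainermanSzeftel2021, eq. (3.5.1) BA-B, TeX l.6353–6356; KlainermanSzeftel2023, eq. (3.5.1) BA-B, HAL hal-04280491 p. 146 L24–26 (= e-print)] -/
def BA_B (X : S.M) : Prop :=
  NSup S X c.klarge + |S.mass X - c.m0| + |S.angm X - c.a0| ≤ c.ε

/-- **BA-D** (Bootstrap Assumptions on decay), KS (3.5.2) l.6360–6363, verbatim: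
`𝔑^(Dec)_{k_small} ≤ ε`.  `[J]` (3.5.2), HAL hal-04280491 p. 146 L27–29: verbatim the same ("We shall
often refer to them in the text as BA_ε", L30, likewise).
[cite: KlainermanSzeftel2021, eq. (3.5.2) BA-D, TeX l.6360–6363; KlainermanSzeftel2023, eq. (3.5.2) BA-D, HAL hal-04280491 p. 146 L27–29 (= e-print)] -/
def BA_D (X : S.M) : Prop := NDec S X c.ksmall ≤ c.ε

/-- The dominance condition for `r` on `S_*`, KS (3.4.5) (l.6102–6107, also l.6750–6753), verbatim:
`r_* = δ_* ε0⁻¹ u_*^{1+δdec}` ("where `r_*` and `u_*` denote respectively the value of `r` and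
`u` on `S_*`").  `[J]` (3.4.5), HAL hal-04280491 p. 140 L27–31: verbatim the same.
[cite: KlainermanSzeftel2021, eq. (3.4.5), TeX l.6102–6107; KlainermanSzeftel2023, eq. (3.4.5), HAL hal-04280491 p. 140 L27–31 (= e-print)] -/
def DomCond (X : S.M) : Prop :=
  S.rstar X = c.δstar * c.ε0⁻¹ * (S.ustar X) ^ (1 + c.δdec)

/-- Membership `X ∈ 𝒰(u)` — KS Definition 3.7.1 (l.6744–6760): "the set of
all GCM admissible spacetimes `ℳ` … such that • `u_*` is the value of `u` on the last sphere `S_*`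
of `Σ_*`, • `r_* = δ_* ε0⁻¹ u_*^{1+δdec}`, • relative to the combined norms … we have
`𝔑^(Sup)_{k_large} ≤ ε, 𝔑^(Dec)_{k_small} ≤ ε` [footnote l.6755: "i.e. the bootstrap assumptions
(3.5.1) (3.5.2) hold true"]."  TYPING CHOICE (recorded in the cell's DIVERGENCE.md): the displayed
third bullet omits the term `|m − m0| + |a − a0|` of (3.5.1) while the footnote says the bullet IS
(3.5.1)–(3.5.2); we type the footnote's reading (`BA_B ∧ BA_D`), which is the one the continuity
argument needs (Theorems M0–M5 are stated "under BA-B and BA-D").  KS also writes this set `ℵ(u_*)`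
(l.6785–6808, 21617).  `[J]` Definition 3.7.1, HAL hal-04280491 p. 158 L31 – p. 159 L5 with footnote 32
(p. 159 L34: "I.e. the bootstrap assumptions (3.5.1) (3.5.2) hold true"): verbatim the same — the
display/footnote discrepancy and the `ℵ(u_*)` notation (p. 159 L19, L22, L25; p. 551 L24–28) persist in
the refereed text.
[cite: KlainermanSzeftel2021, Definition 3.7.1, TeX l.6744–6760; KlainermanSzeftel2023, Definition 3.7.1 with footnote 32, HAL hal-04280491 p. 158 L31 – p. 159 L5 (= e-print)] -/
structure InU (u : ℝ) (X : S.M) : Prop where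
  ustar_eq : S.ustar X = u
  dom : DomCond S X
  baB : BA_B S X
  baD : BA_D S X

/-- KS Definition 3.7.2 (l.6762–6764), verbatim: "We define `𝒰` to be the set of all values of
`u_* ≥ 0` for which the spacetime `𝒰(u_*)` exists" — read: for which `𝒰(u_*)` is nonempty.
`[J]` Definition 3.7.2, HAL hal-04280491 p. 159 L6–7: verbatim the same.
[cite: KlainermanSzeftel2021, Definition 3.7.2, TeX l.6762–6764; KlainermanSzeftel2023, Definition 3.7.2, HAL hal-04280491 p. 159 L6–7 (= e-print)] -/
def Uset : Set ℝ := {u : ℝ | 0 ≤ u ∧ ∃ X : S.M, InU S u X}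

/-! ## §3.4 Initial data layer assumptions -/

/-- Main Theorem hypothesis (3.4.7), KS l.6211–6212, verbatim: `𝓘_{k_large+10} ≤ ε0²`
("(ε0, k_large+10)-admissible initial data layer", Def. 3.4.2 l.6138–6142).  `[J]` (3.4.7), HAL
hal-04280491 p. 143 L2–6 (Def. 3.4.2 p. 141 L6–13): verbatim the same, footnote 18 (p. 143 L68–70)
included.
[cite: KlainermanSzeftel2021, eq. (3.4.7), TeX l.6211–6212; KlainermanSzeftel2023, eq. (3.4.7), HAL hal-04280491 p. 143 L5–6 (= e-print)] -/
def IDLMain (S : Setting c) : Prop := S.idl (c.klarge + 10) ≤ c.ε0 ^ 2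

/-- The "weaker analog" (3.4.11), KS Remark 3.4.8 l.6326–6330, verbatim:
`𝓘_{k_large+10} ≤ ε0, ^(ext)𝓘_3 ≤ ε0²`; it is the hypothesis under which the Main PT-Theorem
(l.24055–24058) and Theorem M0-PT (l.24332–24334) are stated, and (Remark 3.4.8) what the proofs of
Theorems M0 and M6 actually use.  `[J]` Remark 3.4.8 with (3.4.11), HAL hal-04280491 p. 146 L2–18:
verbatim the same (its cross-references now read Remark 8.2.8, §8.3 / Remark 8.3.12, §8.4 /
Remark 8.4.1); `[J]` Theorem 9.4.10 (p. 615 L75–77) and Theorem 9.4.12 (p. 623 L25–27) keep (3.4.11) as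
their displayed hypothesis.
[cite: KlainermanSzeftel2021, Remark 3.4.8 eq. (3.4.11), TeX l.6326–6330; KlainermanSzeftel2023, Remark 3.4.8 eq. (3.4.11), HAL hal-04280491 p. 146 L2–18 (= e-print)] -/
def IDLWeak (S : Setting c) : Prop := S.idl (c.klarge + 10) ≤ c.ε0 ∧ S.idlExt3 ≤ c.ε0 ^ 2

/-- The displayed hypothesis of Theorem M0, KS l.6650–6653, verbatim: `𝓘_{k_large+10} ≤ ε0`.
`[J]` Theorem M0, HAL hal-04280491 p. 156 L57–58: verbatim the same.
[cite: KlainermanSzeftel2021, Theorem M0 hypothesis, TeX l.6650–6653; KlainermanSzeftel2023, Theorem M0 hypothesis, HAL hal-04280491 p. 156 L57–58 (= e-print)] -/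
def IDLM0 (S : Setting c) : Prop := S.idl (c.klarge + 10) ≤ c.ε0

/-- (3.4.7) ⇒ (3.4.11), given `^(ext)𝓘_3 ≤ 𝓘_{k_large+10}` (the initial data layer norm `𝓘_k`
is a sup over the ext and int layers and over `𝔡^{≤k}` derivatives — an explicit hypothesis here,
a property of the instantiating norms) and `0 < ε0 < 1`.  KS Remark 3.4.8 ("can in fact be
replaced by its weaker analog"). [cite: KlainermanSzeftel2021, Remark 3.4.8, TeX l.6326–6330] -/
theorem idlWeak_of_idlMain (hext : S.idlExt3 ≤ S.idl (c.klarge + 10)) (h0 : 0 < c.ε0)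
    (h1 : c.ε0 < 1) (h : IDLMain S) : IDLWeak S :=
  ⟨h.trans (eps0_sq_le c.ε0 h0 h1), hext.trans h⟩

/-- (3.4.11) contains Theorem M0's displayed hypothesis `𝓘_{k_large+10} ≤ ε0` (first conjunct).
[cite: KlainermanSzeftel2021, Remark 3.4.8, TeX l.6326–6330] -/
theorem idlM0_of_idlWeak (h : IDLWeak S) : IDLM0 S := h.1

end Norms

/-! ## §3.7.1 Main intermediate results: Theorems M0–M8 as hypothesis nodes (KS l.6640–6729) -/

section Nodes
variable (K : LesConstants) (S : Setting c)

/-- The three conclusions of Theorem M0 for the spacetime `X` (KS l.6654–6666): curvature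
control `≲ ε0` on `𝓑_1` (first display, `m0Ext`), on `𝓑̲_1` (second display, `m0Int`), and
verbatim `sup_{𝓑_1 ∪ 𝓑̲_1} (|m − m0| + |a − a0|) ≲ ε0` — `(m, a)` being the constants of `X`,
the last is `|mass X − m0| + |angm X − a0| ≤ cM0 ε0`.  `[J]` Theorem M0, HAL hal-04280491 p. 156
L60 – p. 157 L51: the same three displays verbatim.
[cite: KlainermanSzeftel2021, Theorem M0 conclusions, TeX l.6654–6666; KlainermanSzeftel2023, Theorem M0 conclusions, HAL hal-04280491 p. 156 L60 – p. 157 L51 (= e-print)] -/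
def M0Concl (X : S.M) : Prop :=
  S.m0Ext X ≤ K.cM0 * c.ε0 ∧ S.m0Int X ≤ K.cM0 * c.ε0 ∧
    |S.mass X - c.m0| + |S.angm X - c.a0| ≤ K.cM0 * c.ε0

/-- **Theorem M0** as displayed (KS l.6649–6667): "Assume that the initial data layer `𝓛0` …
satisfies `𝓘_{k_large+10} ≤ ε0`.  Then under the bootstrap assumptions BA-B and BA-D, the
following holds true on the initial data hypersurface `𝓑_1 ∪ 𝓑̲_1`, [three displays]."
Proved in KS ch. 8.  NOTE: by KS Remark 3.4.8 (l.6331–6337) the proof uses `^(ext)𝓘_3 ≤ ε0²`,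
which is NOT among the displayed hypotheses; `ThmM0` below is the form with the hypothesis actually
used.  Hypothesis node (statement shape), not an asserted fact.  `[J]` Theorem M0, HAL hal-04280491
p. 156 L57 – p. 157 L51: verbatim the same statement (proved in `[J]` §8.3).
[cite: KlainermanSzeftel2021, Theorem M0 as displayed, TeX l.6649–6667; KlainermanSzeftel2023, Theorem M0, HAL hal-04280491 p. 156 L57 – p. 157 L51 (= e-print)] -/
def ThmM0verbatim (K : LesConstants) (S : Setting c) : Prop :=
  IDLM0 S → ∀ X : S.M, BA_B S X → BA_D S X → M0Concl K S X

/-- **Theorem M0**, operative form: hypothesis (3.4.11) (`IDLWeak`) instead of `𝓘 ≤ ε0` — see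
`ThmM0verbatim` and `thmM0_of_verbatim`.  Hypothesis node.  (`[J]`: Theorem M0 p. 156 L57 – p. 157
L51 and Remark 3.4.8 p. 146 L2–18, both verbatim the e-print's.)
[cite: KlainermanSzeftel2021, Theorem M0 with Remark 3.4.8, TeX l.6649–6667 and l.6331–6337; KlainermanSzeftel2023, Theorem M0 with Remark 3.4.8, HAL hal-04280491 p. 156–157 and p. 146 (= e-print)] -/
def ThmM0 (K : LesConstants) (S : Setting c) : Prop :=
  IDLWeak S → ∀ X : S.M, BA_B S X → BA_D S X → M0Concl K S X

/-- The displayed Theorem M0 implies its operative form (the displayed hypothesis is weaker than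
(3.4.11)). [cite: KlainermanSzeftel2021, Remark 3.4.8, TeX l.6331–6337] -/
theorem thmM0_of_verbatim (h : ThmM0verbatim K S) : ThmM0 K S :=
  fun hidl X hB hD => h (idlM0_of_idlWeak S hidl) X hB hD

/-- **Theorem M1** (KS l.6670–6689): "Assume given a GCM admissible spacetime `ℳ` … verifying
the bootstrap assumptions BA-B and BA-D for some sufficiently small `ε > 0`.  Then, if `ε0 > 0` is
sufficiently small, there exists `δ_extra > δdec` such that we have the following estimates in `ℳ`,
1. [sup-norm estimate for `𝔡^k 𝔮`, `k ≤ k_small+100`, on `ℳ^(ext)` and `ℳ^(int) ∪ ℳ^(top)`]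
`≲ ε0`; moreover [flux of `𝔡^{k-1}∇_3 𝔮` on `Σ_*(≥ u)`] `≲ ε0²`; 2. [the estimate for `A`,
`k ≤ k_small+100`] `≲ ε0`."  Proved in GKS (arXiv:2205.14808, Theorem M1 restated there l.1817ff;
KS l.7639).  The KS ↔ GKS restatement is a separate node of the cell's DAG, not an alias.  The
standing initial-data assumption of §3.7 is made explicit as `IDLWeak`.  Hypothesis node.
JOURNAL (`[J]` Theorem M1, HAL hal-04280491 p. 157 L52–106 with footnote 31, L107–108): "… there exists
`δ_extra > δ_dec` such that we have the following estimates in `ℳ`³¹, with respect to the global frame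
of Proposition 3.6.9, 1. The quantity `𝔮` verifies the estimates `max_{0≤k≤k_small+100} sup_{Σ_*} {(r
u^{1/2+δ_extra} + u^{1+δ_extra})|𝔡^k𝔮| + r u^{1+δ_extra}|𝔡^{k−1}∇₃𝔮|} ≲ ε0`.  Moreover, `𝔮` also satisfies
the following estimate `max_{0≤k≤k_small+100} u^{2+2δ_extra} ∫_{Σ_*(≥u)} |𝔡^{k−1}∇₃𝔮|² ≲ ε0²`.  2. The
quantity `A` verifies the estimate, for all `k ≤ k_small+100`, [the four-term sup display transcribed
in `Setting`'s docstring] `≲ ε0`."; footnote 31: "Even though we only state below estimates on `ℳ^(int)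
∪ ℳ^(ext)`, which is not causal, the actual estimates are in fact proved on the full spacetime `ℳ` which
is itself causal."  So: a Δ of CARRIER in item 1 (`Σ_*` only; e-print l.6674–6679: `ℳ^(ext)`, plus a
`ℳ^(int) ∪ ℳ^(top)` term) and of WEIGHTS in item 2 (e-print l.6684–6686), the flux display unchanged;
`[J]` §3.9 (p. 183 L22–23): "proved in Part II of [28]" (= GKS).  The LOGICAL SHAPE typed here —
`∃ δ_extra > δ_dec`, three functionals bounded by `cM1 ε0`, `(cM1 ε0)²`, `cM1 ε0` — is common to both
versions: `m1Sup/m1Flux/m1A` are read as the left-hand sides of the version the instance transcribes.  No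
journal variant is needed.
[cite: KlainermanSzeftel2021, Theorem M1, TeX l.6670–6689; KlainermanSzeftel2023, Theorem M1, HAL hal-04280491 p. 157 L52–108 (Δ: carrier Σ_* in item 1, weights in item 2; same shape)] -/
def ThmM1 (K : LesConstants) (S : Setting c) : Prop := IDLWeak S → ∀ X : S.M, BA_B S X → BA_D S X →
  ∃ δextra : ℝ, c.δdec < δextra ∧ S.m1Sup X δextra ≤ K.cM1 * c.ε0 ∧
    S.m1Flux X δextra ≤ (K.cM1 * c.ε0) ^ 2 ∧ S.m1A X δextra ≤ K.cM1 * c.ε0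

/-- **Theorem M2** (KS l.6691–6697): "Under the same assumptions as above [those of Theorem M1]
we have the following decay estimates for `α̲`:
`^(int)𝔇_{k_small+80}[α̲] + ^(top)𝔇_{k_small+80}[α̲] ≲ ε0`,
`max_{0≤k≤k_small+80} ∫_{Σ_*} u^{2+2δdec} |𝔡^k α̲|² ≲ ε0²`."  Proved in GKS (KS l.7639); the
cell's GAPS.md G-2/E2/E19 record which clauses have a source in GKS.  Hypothesis node.
JOURNAL (`[J]` Theorem M2, HAL hal-04280491 p. 158 L2–9), verbatim: "Under the same assumptions as above
we have the following decay estimates for `α̲`, with respect to the global frame of Proposition 3.6.11,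
`max_{0≤k≤k_small+80} ∫_{Σ_*} u^{2+2δ_dec}|𝔡^kα̲|² ≲ ε0²`." — the FIRST clause of the e-print is
DELETED (the question "which clauses have a source in GKS" is thereby settled in print: only the flux is
imported; the `ℳ^(int)`/`ℳ^(top)` decay of `A̲` is derived in `[J]` ch. 7, Prop. 7.3.1 p. 427 L17–21 and
Prop. 7.6.1 p. 447, from the control on `𝒯` resp. `{u = u_*}`, i.e. inside Theorem M5's proof from
Theorem M4's output — exactly the edge `ThmM5fromM4`).  This v1 shape is KEPT (importers); the journal
shape is `ThmM2J` (section `Journal`), implied by this one (`thmM2J_of_thmM2`).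
[cite: KlainermanSzeftel2021, Theorem M2, TeX l.6691–6697; KlainermanSzeftel2023, Theorem M2, HAL hal-04280491 p. 158 L2–9 (Δ: first clause deleted — see ThmM2J)] -/
def ThmM2 (K : LesConstants) (S : Setting c) : Prop := IDLWeak S → ∀ X : S.M, BA_B S X → BA_D S X →
  S.m2Dec X ≤ K.cM2 * c.ε0 ∧ S.m2Flux X ≤ (K.cM2 * c.ε0) ^ 2

/-- **Theorem M3** (KS l.6700–6706): "Under the same assumptions as above [as in M2] we have
the following decay estimates on `Σ_*`: `^*𝔇_{k_small+60} ≲ ε0`."  Proved in KS ch. 5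
(uses Theorems M1, M2: intro l.1520).  Hypothesis node.  `[J]` Theorem M3, HAL hal-04280491 p. 158
L10–12: verbatim the same (proved in `[J]` ch. 5; `[J]` intro p. 43 L28–30 = l.1520).
[cite: KlainermanSzeftel2021, Theorem M3, TeX l.6700–6706; KlainermanSzeftel2023, Theorem M3, HAL hal-04280491 p. 158 L10–12 (= e-print)] -/
def ThmM3 (K : LesConstants) (S : Setting c) : Prop := IDLWeak S → ∀ X : S.M, BA_B S X → BA_D S X →
  S.starD X (c.ksmall + 60) ≤ K.cM3 * c.ε0

/-- **Theorem M4** (KS l.6709–6715): "Under the same assumptions as above we have the following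
decay estimates on `ℳ^(ext)`: `^(ext)𝔇_{k_small+40} ≲ ε0`."  Proved in KS ch. 6 (extends M3
from `Σ_*` to `ℳ^(ext)`: intro l.1542–1543).  Hypothesis node.  `[J]` Theorem M4, HAL hal-04280491
p. 158 L13–15: verbatim the same (`[J]` intro p. 44 L14–16 = l.1542–1543).
[cite: KlainermanSzeftel2021, Theorem M4, TeX l.6709–6715; KlainermanSzeftel2023, Theorem M4, HAL hal-04280491 p. 158 L13–15 (= e-print)] -/
def ThmM4 (K : LesConstants) (S : Setting c) : Prop := IDLWeak S → ∀ X : S.M, BA_B S X → BA_D S X →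
  S.extD X (c.ksmall + 40) ≤ K.cM4 * c.ε0

/-- **Theorem M5** (KS l.6718–6723): "Under the same assumptions as above we also have the
following decay estimates in `ℳ^(int)` and `ℳ^(top)`:
`^(int)𝔇_{k_small+20} + ^(top)𝔇_{k_small+20} ≲ ε0`."  Proved in KS ch. 7.  Hypothesis node.
`[J]` Theorem M5, HAL hal-04280491 p. 158 L16–18: verbatim the same.
[cite: KlainermanSzeftel2021, Theorem M5, TeX l.6718–6723; KlainermanSzeftel2023, Theorem M5, HAL hal-04280491 p. 158 L16–18 (= e-print)] -/
def ThmM5 (K : LesConstants) (S : Setting c) : Prop := IDLWeak S → ∀ X : S.M, BA_B S X → BA_D S X →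
  S.intD X (c.ksmall + 20) + S.topD X (c.ksmall + 20) ≤ K.cM5 * c.ε0

/-- The improved decay bound (3.7.1), KS l.6726–6729, verbatim: "as an immediate consequence of
Theorem M1 to Theorem M5, we have obtained, under the same assumptions as above, the following
improvement of our bootstrap assumptions on decay `𝔑^(Dec)_{k_small+20} ≲ ε0`."  Constant:
`cDec = cM3 + cM4 + cM5` (PROVED below from M3–M5 and monotonicity of the norms in `k`).
`[J]` (3.7.1), HAL hal-04280491 p. 158 L19–23: verbatim the same.
[cite: KlainermanSzeftel2021, eq. (3.7.1), TeX l.6726–6729; KlainermanSzeftel2023, eq. (3.7.1), HAL hal-04280491 p. 158 L19–23 (= e-print)] -/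
def ImprovedDecay (X : S.M) : Prop := NDec S X (c.ksmall + 20) ≤ K.cDec * c.ε0

/-- What Theorem M7 delivers about the extended spacetime `X'` of `X` (KS l.6791–6800): `X'`
extends `X` and is the one constructed in KS §8.9; `u_*' > u_*` (l.6796; proved as
l.22345–22346: `ũ(S̃_*) > u_*`); the dominance condition (l.6796 "verifying (3.4.5)";
l.22333–22336); "initialized by Theorem M0" read as: the first two conclusions of Theorem M0
(curvature control `≲ ε0` on `𝓑_1 ∪ 𝓑̲_1`) hold for `X'` (`init`); the closeness of the new
constants `|m' − m0| + |a' − a0| ≲ ε0` (`param` — NOT displayed in Theorem M7; obtained from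
Theorem M0 (iii) for `X` and KS (l.22970–22972) `|m̃ − m| + |ã − a| ≲ ε0`, see
`param_bookkeeping`; the cell's GAPS.md Q4); and verbatim `𝔑^(Dec)_{k_small} ≲ ε0` (l.6798;
proved l.23049–23053).  Output constant `cM7`.  `[J]` loci (HAL hal-04280491), all verbatim the
e-print's: Theorem M7 p. 159 L25–33; `ũ(S̃_*) > u_*` (8.5.40) p. 571; dominance Step 12 p. 569 L48ff;
`|m̃ − m| + |ã − a| ≲ ε0` inside (8.5.63) p. 590 L40–59; `𝔑^(Dec)_{k_small}(ℳ̃) ≲ ε0` p. 592 L44–53.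
[cite: KlainermanSzeftel2021, Theorem M7 conclusions, TeX l.6791–6800 and l.22333–23053; KlainermanSzeftel2023, Theorem M7 conclusions, HAL hal-04280491 p. 159 L25–33 and §8.5 p. 569–592 (= e-print)] -/
structure IsM7Extension (X X' : S.M) : Prop where
  extends_ : S.Extends X X'
  built : S.BuiltByM7 X X'
  ustar_lt : S.ustar X < S.ustar X'
  dom : DomCond S X'
  init : S.m0Ext X' ≤ K.cM0 * c.ε0 ∧ S.m0Int X' ≤ K.cM0 * c.ε0
  param : |S.mass X' - c.m0| + |S.angm X' - c.a0| ≤ K.cM7 * c.ε0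
  dec : NDec S X' c.ksmall ≤ K.cM7 * c.ε0

/-- The bookkeeping behind `IsM7Extension.param` (triangle inequality): Theorem M0 (iii) on the
old spacetime, `|m − m0| + |a − a0| ≤ cM0 ε0`, and KS (l.22970–22972) `|m̃ − m| + |ã − a| ≤ c ε0`
give `|m̃ − m0| + |ã − a0| ≤ (cM0 + c) ε0`.  KS states neither this step nor where the `(m, a)`
part of BA-B is re-closed for the extended spacetime (Theorem M8 mentions only `𝔑^(Sup)`).
Elementary. [folklore] -/
theorem param_bookkeeping (m a m' a' m0 a0 C C' ε0 : ℝ) (h0 : |m - m0| + |a - a0| ≤ C * ε0)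
    (h1 : |m' - m| + |a' - a| ≤ C' * ε0) : |m' - m0| + |a' - a0| ≤ (C + C') * ε0 := by
  have hm : |m' - m0| ≤ |m' - m| + |m - m0| := by
    simpa [sub_add_sub_cancel] using abs_add_le (m' - m) (m - m0)
  have ha : |a' - a0| ≤ |a' - a| + |a - a0| := by
    simpa [sub_add_sub_cancel] using abs_add_le (a' - a) (a - a0)
  linarith

/-- **Theorem M6** (KS l.6773–6776), verbatim: "There exists `δ0 > 0` small enough such that for
a sufficiently small constant `ε0 > 0` we have `[1, 1+δ0] ⊂ 𝒰`."  Proved in KS ch. 8 (uses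
`^(ext)𝓘_3 ≤ ε0²`, Remark 3.4.8 l.6335).  Hypothesis node.  `[J]` Theorem M6, HAL hal-04280491 p. 159
L9–10: verbatim the same (proved in `[J]` §8.4).
[cite: KlainermanSzeftel2021, Theorem M6, TeX l.6773–6776; KlainermanSzeftel2023, Theorem M6, HAL hal-04280491 p. 159 L9–10 (= e-print)] -/
def ThmM6 (S : Setting c) : Prop := IDLWeak S → ∃ δ0 : ℝ, 0 < δ0 ∧ Set.Icc (1 : ℝ) (1 + δ0) ⊆ Uset S

/-- **Theorem M7** (KS l.6791–6800), verbatim: "Any GCM admissible spacetime in `ℵ(u_*)` for some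
`0 < u_* < +∞` such that `𝔑^(Dec)_{k_small+20} ≲ ε0` has a GCM admissible extension verifying
(r_* = δ_* ε0⁻¹ u_*^{1+δdec}), with `u_*' > u_*`, initialized by Theorem M0, which verifies
`𝔑^(Dec)_{k_small} ≲ ε0`."  Proved in KS ch. 8 (§8.8–8.9), using Shen arXiv:2205.12336 (GCM
hypersurfaces) and the GCM papers arXiv:1911.00697, 1912.12195.  The input constant is `cDec`
(fed by (3.7.1)); the output constant is `cM7`.  [The INTRO version, l.1586–1588, says "extension
in `𝒰(u'_*)`"; the ch.-3 statement typed here does not — membership in `𝒰(u'_*)` is the business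
of Theorem M8.]  Hypothesis node.  `[J]` Theorem M7, HAL hal-04280491 p. 159 L25–33: verbatim the same
(`ℵ(u_*)` included); proved in `[J]` §8.5 (e-print §8.9), whose external inputs are cited there as
"[41]" (= arXiv:1912.12195, restated as `[J]` Theorem 8.1.7 / Corollary 8.1.8) and "[50]" (= Shen,
restated as `[J]` Theorem 8.1.11).
[cite: KlainermanSzeftel2021, Theorem M7, TeX l.6791–6800; KlainermanSzeftel2023, Theorem M7, HAL hal-04280491 p. 159 L25–33 (= e-print)] -/
def ThmM7 (K : LesConstants) (S : Setting c) : Prop :=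
  IDLWeak S → ∀ (X : S.M) (u : ℝ), 0 < u → InU S u X →
  ImprovedDecay K S X → ∃ X' : S.M, IsM7Extension K S X X'

/-- **Theorem M8** (KS l.6803–6809), verbatim: "The GCM admissible spacetime exhibited in Theorem
M7 satisfies in addition `𝔑^(Sup)_{k_large} ≲ ε0` and therefore belongs to `ℵ(u_*')`.  In
particular `u_*'` belongs to `𝒰`."  Typed: every `X'` with the properties delivered by Theorem M7
for some `X ∈ 𝒰(u)` satisfies `𝔑^(Sup)_{k_large}(X') ≤ cM8 ε0` (the "therefore belongs to
`ℵ(u_*')`" clause is PROVED below, `extension_mem_U`, under the explicit smallness of `ε0`).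
Proved in KS ch. 9 ASSUMING the curvature estimates of GKS (KS l.7641, 7656; Theorem 9.4.15 =
GKS Theorem restated l.1857ff); sub-DAG in section `Ch9` below.  Hypothesis node.  `[J]` Theorem M8,
HAL hal-04280491 p. 160 L2–8: verbatim the same; `[J]` §3.9 (p. 183 L24–25, L34–35, footnote 38 L40): "The
control of the curvature components in Theorem M8, concerning top order boundedness estimates, is derived
in Part III of [28]" (e-print l.7641: "will be proved in [KS:Kerr-B]", a then-separate paper, since merged
into GKS).
[cite: KlainermanSzeftel2021, Theorem M8, TeX l.6803–6809; KlainermanSzeftel2023, Theorem M8, HAL hal-04280491 p. 160 L2–8 (= e-print)] -/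
def ThmM8 (K : LesConstants) (S : Setting c) : Prop :=
  IDLWeak S → ∀ (X X' : S.M) (u : ℝ), InU S u X →
  IsM7Extension K S X X' → NSup S X' c.klarge ≤ K.cM8 * c.ε0

/-- "ε0 sufficiently small" as actually consumed by the continuity argument: the improved bounds
of M7/M8 (`≤ c·ε0`) must be `≤ ε`: BA-B for the extension needs `(cM8 + cM7) ε0 ≤ ε`, BA-D needs
`cM7 ε0 ≤ ε`.  By `eps_arith` this holds as soon as `ε = ε0^{2/3}` and `ε0 ≤ (cM8 + cM7)⁻³`,
`ε0 ≤ cM7⁻³` (see `smallEps_of_admissible`) — the constants being independent of `ε0`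
(KS l.6117), this is a legitimate choice of `ε0`.  (`[J]` §3.7.2, HAL hal-04280491 p. 159 L8–p. 160
L12, and (3.4.4) p. 140 L19–22: verbatim the same.)
[cite: KlainermanSzeftel2021, §3.7.2 "for ε0 sufficiently small" with (3.4.4), TeX l.6090–6091 and l.6778–6813; KlainermanSzeftel2023, §3.7.2 with (3.4.4), HAL hal-04280491 p. 159–160 and p. 140 L19–22 (= e-print)] -/
def SmallEps (K : LesConstants) (c : Constants) : Prop :=
  (K.cM8 + K.cM7) * c.ε0 ≤ c.ε ∧ K.cM7 * c.ε0 ≤ c.ε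

/-- `SmallEps` from admissible constants with `ε0` below the two explicit thresholds (via
`eps_arith`). [cite: KlainermanSzeftel2021, eq. (3.4.4), TeX l.6090–6091] -/
theorem smallEps_of_admissible (hc : c.Admissible) (h87 : 0 < K.cM8 + K.cM7) (h7 : 0 < K.cM7)
    (hs1 : c.ε0 ≤ ((K.cM8 + K.cM7)⁻¹) ^ (3 : ℕ)) (hs2 : c.ε0 ≤ (K.cM7⁻¹) ^ (3 : ℕ)) :
    SmallEps K c := by
  refine ⟨?_, ?_⟩
  · rw [hc.ε_eq]; exact eps_arith _ _ h87 hc.ε0_pos hs1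
  · rw [hc.ε_eq]; exact eps_arith _ _ h7 hc.ε0_pos hs2

/-! ### The three steps KS asserts but does not prove (explicit hypothesis nodes) -/

/-- **FlowClosed** — KS l.6783–6785, verbatim: "Assume by contradiction that `U_* < +∞`.  Then,
by the continuity of the flow, `U_* ∈ 𝒰`."  No proof or reference is given in KS; `𝒰(u_*)` is a
family of spacetimes each carrying its own GCM hypersurface `Σ_*` and re-initialised gauges, not
the orbit of a flow, so closedness of `𝒰` under suprema is a genuine (compactness / uniform
local-existence) statement.  Typed as exactly what is used.  ASSERTED, NOT PROVED in the source
(the cell's GAPS.md Q1); hypothesis node.  `[J]` §3.7.2, HAL hal-04280491 p. 159 L16–18, verbatim: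
"Assume by contradiction that … `U_* < +∞`.  Then, by the continuity of the flow, `U_* ∈ 𝒰`." — the
sentence is unchanged and still unreferenced in the refereed text.
[cite: KlainermanSzeftel2021, §3.7.2 "by the continuity of the flow" (asserted without proof), TeX l.6783–6785; KlainermanSzeftel2023, §3.7.2, HAL hal-04280491 p. 159 L16–18 (= e-print, still without proof or reference)] -/
def FlowClosed (S : Setting c) : Prop :=
  BddAbove (Uset S) → (Uset S).Nonempty → sSup (Uset S) ∈ Uset S

/-- The combined estimate (3.4.8) of the Main Theorem for a limiting spacetime `Y` and final
parameters `(a, m)`, KS l.6217–6221, verbatim: "There exist constants `(a_∞, m_∞)`,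
`|a_∞| ≪ m_∞`, such that … `𝔑^(Sup)_{k_large} + 𝔑^(Dec)_{k_small} + |a_∞ − a0| + |m_∞ − m0|
≤ C ε0` where `C` is a universal constant sufficiently large".  `|a_∞| ≪ m_∞` is typed by its
shadow `|a| < m`.  `[J]` (3.4.8), HAL hal-04280491 p. 143 L9–23: verbatim the same.
[cite: KlainermanSzeftel2021, Main Theorem v2 eq. (3.4.8), TeX l.6217–6221; KlainermanSzeftel2023, Main Theorem v2 eq. (3.4.8), HAL hal-04280491 p. 143 L9–23 (= e-print)] -/
def MainEstimate (Y : S.Minf) (a m : ℝ) : Prop :=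
  |a| < m ∧ S.nSupInf Y a m + S.nDecInf Y a m + |a - c.a0| + |m - c.m0| ≤ K.cMain * c.ε0

/-- **LimitExists** — the passage to the limit `u_* → +∞`, KS §3.8 l.6832 ("We denote by `ℳ` our
global spacetime obtained in the limit `u_* → +∞`"), l.6848–6851 ("as a consequence of Theorem
M0, the parameters `(m_∞, a_∞)` obtained in the limit satisfy `|m_∞ − m0| + |a_∞ − a0| ≲ ε0`"),
and Main Theorem item 2 (l.6223: "`ℳ_∞` is a limit of finite GCM admissible spacetimes").  KS
gives no construction of the limit (existence of `ℳ_∞` as an admissible future null complete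
development, convergence of `(m, a)` along the family, transfer of the uniform bounds to the norms
of `ℳ_∞` computed w.r.t. `(a_∞, m_∞)`).  Typed as exactly what is used: unboundedness of `𝒰`
yields a limit object satisfying (3.4.8).  ASSERTED, NOT PROVED in the source (the cell's
GAPS.md Q2); hypothesis node.  `[J]` §3.8, HAL hal-04280491 p. 161 L17 – p. 162 L5 ((3.8.1)–(3.8.4)) and
Main Theorem item 2 with footnote 19 (p. 143 L24, L71–72: "they are the limits of the GCM family
`𝒰(u_*)`, as in Definition 3.7.1. Note also that `ℳ^(top)` disappears in the limit"): verbatim the same —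
no construction of the limit is added in the refereed text.
[cite: KlainermanSzeftel2021, §3.8 the limit u_* → +∞ (asserted without construction), TeX l.6832–6851; KlainermanSzeftel2023, §3.8 and Main Theorem item 2, HAL hal-04280491 p. 161 L17 – p. 162 L5 and p. 143 L24 (= e-print)] -/
def LimitExists (K : LesConstants) (S : Setting c) : Prop := ¬ BddAbove (Uset S) →
  ∃ Y : S.Minf, S.IsLimitOfU Y ∧ ∃ a m : ℝ, MainEstimate K S Y a m

/-- **Conclusions** — KS Remark 3.4.7, l.6322–6324: "The items 1–5 are important corollaries of
those estimates, to be treated as conclusions in section 3.8" (§3.8 = l.6822–7632: complete `𝓘⁺`,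
future event horizon, Bondi mass and its limit `m_∞`, angular momentum limit `2 a_∞ m_∞`,
coordinate patches).  One node: (3.4.8) for `(Y, a, m)` implies items 1–4 for `(Y, a, m)`.
Hypothesis node.  `[J]` Remark 3.4.7, HAL hal-04280491 p. 145 L65–68, and §3.8, p. 161 L17ff: verbatim
the same plan.
[cite: KlainermanSzeftel2021, Remark 3.4.7 and §3.8, TeX l.6322–6324 and l.6858–7630; KlainermanSzeftel2023, Remark 3.4.7 and §3.8, HAL hal-04280491 p. 145 L65–68 and p. 162ff (= e-print)] -/
def ThmConclusions (K : LesConstants) (S : Setting c) : Prop :=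
  ∀ (Y : S.Minf) (a m : ℝ), MainEstimate K S Y a m → S.Conclusions Y a m

/-- **Main Theorem (version 2)**, KS l.6208–6224 + 6251–6318, as typed over the setting:
under (3.4.7) [`|a0|/m0` small, `k_large` large, `ε0` small being carried by `Constants.Admissible`
and the explicit thresholds], `𝓛0` possesses an admissible future null complete development `ℳ_∞`
which is a limit of the GCM family `𝒰(u_*)`, with final parameters `(a_∞, m_∞)` satisfying (3.4.8)
and the conclusions 1–4.  A statement SHAPE over the abstract carrier — not a restatement of the
tree's named fact `klainerman_szeftel_kerr_stability_small_a_cauchy` (different typing, no relation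
claimed).  `[J]` Main Theorem (version 2), HAL hal-04280491 p. 143 L2–24: verbatim the same statement.
[cite: KlainermanSzeftel2021, Main Theorem version 2, TeX l.6207–6224; KlainermanSzeftel2023, Main Theorem version 2, HAL hal-04280491 p. 143 L2–24 (= e-print)] -/
def MainTheoremV2 (K : LesConstants) (S : Setting c) : Prop := IDLMain S →
  ∃ Y : S.Minf, S.IsLimitOfU Y ∧ ∃ a m : ℝ, MainEstimate K S Y a m ∧ S.Conclusions Y a m

end Nodes

/-! ## PROOFS: the logic of KS §3.7.2 (l.6735–6813) -/

section Proofs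
variable {K : LesConstants} {S : Setting c}

/-- (3.7.1) from Theorems M3, M4, M5 (KS l.6726–6729: "immediate consequence of Theorem M1 to
Theorem M5" — M1, M2 enter only through the proofs of M3–M5).  Uses only that the regional decay
norms are nondecreasing in the number of derivatives (`k_small+20 ≤ k_small+40 ≤ k_small+60`).
PROVED. [cite: KlainermanSzeftel2021, eq. (3.7.1), TeX l.6726–6729; KlainermanSzeftel2023, eq. (3.7.1), HAL hal-04280491 p. 158 L19–23 (= e-print)] -/
theorem improvedDecay_of_M3_M4_M5 (h3 : ThmM3 K S) (h4 : ThmM4 K S) (h5 : ThmM5 K S)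
    (hidl : IDLWeak S) (X : S.M) (hB : BA_B S X) (hD : BA_D S X) : ImprovedDecay K S X := by
  have e3 := h3 hidl X hB hD
  have e4 := h4 hidl X hB hD
  have e5 := h5 hidl X hB hD
  have m3 : S.starD X (c.ksmall + 20) ≤ S.starD X (c.ksmall + 60) := S.starD_mono X (by omega)
  have m4 : S.extD X (c.ksmall + 20) ≤ S.extD X (c.ksmall + 40) := S.extD_mono X (by omega)
  unfold ImprovedDecay NDec LesConstants.cDec
  linarith

/-- Theorem M8, second clause (KS l.6808): the extension "therefore belongs to `ℵ(u_*')`".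
From `𝔑^(Sup)_{k_large} ≤ cM8 ε0` (M8), `|m' − m0| + |a' − a0| ≤ cM7 ε0` (`IsM7Extension.param`),
`𝔑^(Dec)_{k_small} ≤ cM7 ε0` (M7) and `SmallEps`.  PROVED.
[cite: KlainermanSzeftel2021, Theorem M8 second clause, TeX l.6808; KlainermanSzeftel2023, Theorem M8 second clause, HAL hal-04280491 p. 160 L6–8 (= e-print)] -/
theorem extension_mem_U (hsmall : SmallEps K c) {X X' : S.M} (hX' : IsM7Extension K S X X')
    (hsup : NSup S X' c.klarge ≤ K.cM8 * c.ε0) : InU S (S.ustar X') X' := by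
  refine ⟨rfl, hX'.dom, ?_, ?_⟩
  · have hma := hX'.param
    unfold BA_B
    linarith [hsmall.1]
  · unfold BA_D
    linarith [hX'.dec, hsmall.2]

/-- **The continuity argument**, KS l.6778–6813: "In view of Theorem M6, we may define `U_*` as
the supremum over all value of `u_*` that belongs to `𝒰` … Assume by contradiction that
`U_* < +∞`.  Then, by the continuity of the flow, `U_* ∈ 𝒰`.  According to (3.7.1), the bootstrap
assumptions on decay … are improved by `𝔑^(Dec)_{k_small+20} ≲ ε0`. … [Theorem M7] … [Theorem
M8] … In view of Theorem M8, we have reached a contradiction, and hence `U_* = +∞`".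
Typed conclusion: `𝒰` is not bounded above.  Hypotheses: the node Props M6, (3.7.1) (as the
implication BA ⇒ improved decay, itself proved from M3–M5 above), M7, M8, `FlowClosed`,
`SmallEps`, and the initial-data assumption (3.4.11).  PROVED (pure logic + `le_csSup`).  `[J]`
§3.7.2, HAL hal-04280491 p. 159 L8 – p. 160 L12: the same text verbatim ("we may define `U_*` as the
supremum …" L11–15; "by the continuity of the flow" L16–18; (3.7.1) L18–21; "we have reached a
contradiction … the spacetime may be continued forever" p. 160 L9–12).
[cite: KlainermanSzeftel2021, §3.7.2 end of the proof of the main theorem, TeX l.6778–6813; KlainermanSzeftel2023, §3.7.2, HAL hal-04280491 p. 159 L8 – p. 160 L12 (= e-print)] -/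
theorem Uset_not_bddAbove (hidl : IDLWeak S) (hM6 : ThmM6 S)
    (h371 : ∀ X : S.M, BA_B S X → BA_D S X → ImprovedDecay K S X)
    (hM7 : ThmM7 K S) (hM8 : ThmM8 K S) (hflow : FlowClosed S) (hsmall : SmallEps K c) :
    ¬ BddAbove (Uset S) := by
  intro hbdd
  obtain ⟨δ0, hδ0, hsub⟩ := hM6 hidl
  have h1 : (1 : ℝ) ∈ Uset S := hsub ⟨le_refl 1, by linarith⟩
  have hne : (Uset S).Nonempty := ⟨1, h1⟩
  -- "by the continuity of the flow, U_* ∈ 𝒰"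
  obtain ⟨_, X, hX⟩ := hflow hbdd hne
  have hUpos : 0 < sSup (Uset S) := lt_of_lt_of_le one_pos (le_csSup hbdd h1)
  -- (3.7.1): improved decay on the spacetime X ∈ 𝒰(U_*)
  have hdec : ImprovedDecay K S X := h371 X hX.baB hX.baD
  -- Theorem M7: extension X' with u_*' > U_*
  obtain ⟨X', hX'⟩ := hM7 hidl X (sSup (Uset S)) hUpos hX hdec
  -- Theorem M8: improved boundedness, hence X' ∈ 𝒰(u_*') and u_*' ∈ 𝒰
  have hsup : NSup S X' c.klarge ≤ K.cM8 * c.ε0 := hM8 hidl X X' (sSup (Uset S)) hX hX'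
  have hmem' : InU S (S.ustar X') X' := extension_mem_U hsmall hX' hsup
  have hu'U : S.ustar X' ∈ Uset S := by
    refine ⟨?_, X', hmem'⟩
    have := hX'.ustar_lt
    rw [hX.ustar_eq] at this
    linarith
  -- contradiction with U_* = sup 𝒰
  have hle : S.ustar X' ≤ sSup (Uset S) := le_csSup hbdd hu'U
  have hlt : sSup (Uset S) < S.ustar X' := by
    have := hX'.ustar_lt
    rwa [hX.ustar_eq] at this
  exact absurd hle (not_le.mpr hlt)

/-- Equivalent phrasing of `U_* = +∞`: every `u` is exceeded by some `u_* ∈ 𝒰`, i.e. "the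
spacetime may be continued forever" (KS l.6813).  Elementary order fact. [folklore] -/
theorem exists_mem_Uset_gt (h : ¬ BddAbove (Uset S)) (u : ℝ) : ∃ u' ∈ Uset S, u < u' := by
  by_contra hcon
  exact h ⟨u, fun u' hu' => not_lt.mp fun hlt => hcon ⟨u', hu', hlt⟩⟩

/-- The estimate (3.4.8) and the limit object from the node Props (continuity argument +
`LimitExists`).  PROVED.
[cite: KlainermanSzeftel2021, §3.7.2–§3.8, TeX l.6778–6851; KlainermanSzeftel2023, §3.7.2–§3.8, HAL hal-04280491 p. 159–162 (= e-print)] -/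
theorem mainEstimate_of_nodes (hidl : IDLWeak S) (hM3 : ThmM3 K S) (hM4 : ThmM4 K S)
    (hM5 : ThmM5 K S) (hM6 : ThmM6 S) (hM7 : ThmM7 K S) (hM8 : ThmM8 K S)
    (hflow : FlowClosed S) (hsmall : SmallEps K c) (hlim : LimitExists K S) :
    ∃ Y : S.Minf, S.IsLimitOfU Y ∧ ∃ a m : ℝ, MainEstimate K S Y a m :=
  hlim (Uset_not_bddAbove hidl hM6 (improvedDecay_of_M3_M4_M5 hM3 hM4 hM5 hidl) hM7 hM8
    hflow hsmall)

/-- **Main Theorem (version 2) from the node Props.**  Every analytic input is an explicit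
hypothesis: the constants are admissible with `ε0` below the explicit thresholds; (3.4.7) ⇒
(3.4.11) needs `^(ext)𝓘_3 ≤ 𝓘_{k_large+10}` and `ε0 < 1`; Theorems M3–M8 (M0, M1, M2 enter the
DAG only through the proofs of M3–M5, M7, M8 — see the `_of_` lemmas of sections `Ch8`, `Ch9`);
the three unproved steps `FlowClosed`, `LimitExists`, and — inside M8 — `BAPTonExtension`; and
`ThmConclusions` (§3.8).  PROVED.  (Same certificate against `[J]`: every node it consumes is verbatim
the refereed one — HAL hal-04280491 p. 143, 158–162 — Theorem M2's journal change living upstream of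
M3; see `mainTheorem_of_leaves_J`.)
[cite: KlainermanSzeftel2021, Main Theorem version 2 via §3.7.2, TeX l.6207–6224 and l.6778–6813; KlainermanSzeftel2023, Main Theorem version 2 via §3.7.2, HAL hal-04280491 p. 143 and p. 159–160 (= e-print)] -/
theorem mainTheorem_of_nodes (hc : c.Admissible) (hε0 : c.ε0 < 1)
    (hext : S.idlExt3 ≤ S.idl (c.klarge + 10))
    (hM3 : ThmM3 K S) (hM4 : ThmM4 K S) (hM5 : ThmM5 K S) (hM6 : ThmM6 S)
    (hM7 : ThmM7 K S) (hM8 : ThmM8 K S) (hflow : FlowClosed S) (hsmall : SmallEps K c)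
    (hlim : LimitExists K S) (hconcl : ThmConclusions K S) : MainTheoremV2 K S := by
  intro hmain
  have hidl : IDLWeak S := idlWeak_of_idlMain S hext hc.ε0_pos hε0 hmain
  obtain ⟨Y, hY, a, m, hest⟩ :=
    mainEstimate_of_nodes hidl hM3 hM4 hM5 hM6 hM7 hM8 hflow hsmall hlim
  exact ⟨Y, hY, a, m, hest, hconcl Y a m hest⟩

end Proofs

/-! ## Chapter 9: the sub-DAG of Theorem M8 (KS §9.4, l.23850–24740) -/

section Ch9
variable (K : LesConstants) (S : Setting c)

/-- **BA-PT**, KS l.24316–24319, verbatim: "Relative to the global norms defined in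
section 9.4.1 for the PT frames of `ℳ`, we have `𝔖_k + ℜ_k ≤ ε, k ≤ k_large+7`."  Introduced
(l.24313) "To prove Theorem 9.4.10 [Main PT-Theorem]".  Hypothesis node.
JOURNAL (`[J]` §9.4.4, HAL hal-04280491 p. 623 L2–20): the display is kept verbatim as (9.4.21) (L18–20)
but is now PRECEDED by: "The nonlinear error terms in the proof of Theorem 9.4.10 may all be controlled
by the standard estimate `Err_{k_large+7} ≲ (ℜ²_{k_large+7} + 𝔊²_{k_large+7})^{1/2}(ℜ_{k_large+7} +
𝔊_{k_large+7}) ≲ ε(ℜ_{k_large+7} + 𝔊_{k_large+7})` (9.4.20) [the symbol `Err` occurs only here; the exponent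
`1/2` of the first bracket is the cell's reading of the PDF — the deposit's text layer does not render it].
The systematic use of (9.4.20) would result in carrying the term `ε(ℜ_{k_large+7} + 𝔊_{k_large+7})` on the
RHS of all estimates throughout sections 9.6–9.10.  Thus, to lighten notations, it will be convenient to make
instead the following assumption which, by abuse of language, we call BA-T [sic] bootstrap assumptions¹²"
— footnote 12 (L33–34): "In view of (9.4.21), the error terms appearing in sections 9.6–9.10 will be
simply estimated by `O(ε²)` and hence by `O(ε0)`."  The typed node is the display and is unchanged; what
the journal sentence changes is the node's STATUS in print (see `BAPTonExtension`).  (`𝔖`/`𝔊`: one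
norm, two renderings of `\mathfrak`.)
[cite: KlainermanSzeftel2021, §9.4.4 bootstrap assumption BA-PT, TeX l.24313–24319; KlainermanSzeftel2023, §9.4.4 (9.4.20)–(9.4.21) with footnote 12, HAL hal-04280491 p. 623 L2–20 and L33–34 (display = e-print; preamble new)] -/
def BA_PT (X : S.M) : Prop := ∀ k : ℕ, k ≤ c.klarge + 7 → S.ptNorm X k ≤ c.ε

/-- Conclusion of the Main PT-Theorem for `X`: `𝔖_k + ℜ_k ≤ cPT ε0, k ≤ k_large+7`.  `[J]` (9.4.14),
HAL hal-04280491 p. 616 L2–4: verbatim the same.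
[cite: KlainermanSzeftel2021, Theorem 9.4.10 conclusion, TeX l.24053–24064; KlainermanSzeftel2023, Theorem 9.4.10 (9.4.14), HAL hal-04280491 p. 615 L75 – p. 616 L4 (= e-print)] -/
def PTBound (X : S.M) : Prop := ∀ k : ℕ, k ≤ c.klarge + 7 → S.ptNorm X k ≤ K.cPT * c.ε0

/-- **Main PT-Theorem** (KS Theorem 9.4.10, l.24053–24064), verbatim:
"Consider a GCM admissible spacetime verifying the initial data assumptions of the Main Theorem …,
i.e. `𝓘_{k_large+10} ≤ ε0, ^(ext)𝓘_3 ≤ ε0²`.  Then, relative to the global norms … for the PT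
frames of `ℳ`, we have `𝔖_k + ℜ_k ≲ ε0, k ≤ k_large+7`."  Implicit hypotheses made explicit: the
spacetime is the one exhibited in Theorem M7 (its proof, Lemma 9.4.13 l.24363, uses "in view of
Theorem M7" the decay `𝔑^(Dec)_{k_small} ≲ ε0` of the PG structures) and BA-PT (§9.4.4).
Hypothesis node.  `[J]` Theorem 9.4.10, HAL hal-04280491 p. 615 L75 – p. 616 L4: verbatim the same
(and `[J]`'s proof of Lemma 9.4.13, p. 624 L30, still opens "The PG structures of `ℳ` satisfy in view of
Theorem M7 …").
[cite: KlainermanSzeftel2021, Theorem 9.4.10 Main PT-Theorem, TeX l.24053–24064; KlainermanSzeftel2023, Theorem 9.4.10, HAL hal-04280491 p. 615 L75 – p. 616 L4 (= e-print)] -/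
def MainPT (K : LesConstants) (S : Setting c) : Prop :=
  IDLWeak S → ∀ (X X' : S.M) (u : ℝ), InU S u X → IsM7Extension K S X X' →
  BA_PT S X' → PTBound K S X'

/-- **BAPTonExtension** — the undischarged bootstrap hypothesis of chapter 9: BA-PT holds on the
spacetime exhibited in Theorem M7.  KS introduces BA-PT (l.24313–24319) "to prove Theorem 9.4.10"
and improves it to `≲ ε0` (l.24734–24740), but no locus in KS initiates it or runs the continuity
argument that would discharge it (it involves `k ≤ k_large+7` derivatives of the PT frame, more
than BA-B's `k_large`).  Typed as exactly what the application of Theorem 9.4.10 inside the proof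
of Theorem M8 needs.  NOT A STATEMENT OF THE SOURCE — the missing input of the printed M8 proof
(the cell's GAPS.md Q3); hypothesis node.
JOURNAL STATUS (`[J]` §9.4.4, HAL hal-04280491 p. 623 L2–20 with footnote 12; quoted under `BA_PT`): the
refereed text declares (9.4.21) a notational stand-in ("by abuse of language") for the systematic use of
the standard estimate (9.4.20), so as to INTENT it is no longer a bootstrap to be initiated and closed by
a continuity argument.  What (9.4.20) itself presupposes is its second `≲`, i.e. the smallness `≲ ε`
of the TOP-order PT norms `ℜ_{k_large+7}`, `𝔊_{k_large+7}` of the already-constructed spacetime, which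
neither version derives at that point (BA-B/BA-D bound `k ≤ k_large` derivatives of the PG quantities;
Theorem 9.4.12 bounds the data norms `𝓘^PT_k`) — in the journal's own framing the proof of Theorem 9.4.10
is an absorption argument with higher-order error terms, closing for `ℜ + 𝔊` a priori small OR via a
continuity argument in the norm, and the text writes out neither.
The kernel statement is version-independent: `thmM8_of_ch9` certifies that SOME hypothesis of this type
is consumed where Theorem 9.4.10 is applied in the proof of Theorem M8 (`[J]` p. 616 L5 – p. 622 L76,
unchanged); the cell's GAPS.md Q3 carries the print-status adjudication (class Q: a question to the
authors, not an error claim).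
[cite: KlainermanSzeftel2021, §9.4.4 BA-PT transported to the M7 extension (undischarged in print), TeX l.24313–24319 and l.24363; KlainermanSzeftel2023, §9.4.4 (9.4.20)–(9.4.21) and footnote 12, HAL hal-04280491 p. 623 L2–20, L33–34 (BA-PT declared a notational device; second ≲ of (9.4.20) used, not derived)] -/
def BAPTonExtension (K : LesConstants) (S : Setting c) : Prop :=
  ∀ (X X' : S.M) (u : ℝ), InU S u X → IsM7Extension K S X X' →
  BA_PT S X'

/-- **Proof of Theorem M8 from the Main PT-Theorem** (KS §9.4.3, l.24070–24300, Steps 1–6: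
control of `ℋ̌'` on `Σ_*`, Sobolev + trace on the PT frames, transport of the frame coefficients
`(f, f̲, λ)` PT → PG in `ℳ^(ext)`, `ℳ^(top)`, `ℳ^(int)`, change-of-frame formulas; uses the
dominance condition (l.24125)).  Node: the PT bound at order `k_large+7` implies
`𝔑^(Sup)_{k_large} ≤ cM8 ε0` for the M7 spacetime (KS gets `k_large+2`; the node keeps `k_large`,
weaker).  Hypothesis node.  `[J]` §9.4.3, HAL hal-04280491 p. 616 L5 – p. 622 L76: the same six steps
verbatim ((9.4.15)–(9.4.19); "In view of the dominance condition (3.4.5)" p. 617 L36; "for `k ≤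
k_large+2`" p. 621 L8; "This concludes the proof of Theorem M8" p. 622 L76).  The `r`-weight bookkeeping
of Step 3's sup estimate (9.4.17) (p. 617 L39–69, Remark 9.4.11 p. 618) against the weights carried by
`ℜ_k` is the subject of the cell's GAPS.md E28 (an open-priced count, not a typed node here).
[cite: KlainermanSzeftel2021, §9.4.3 proof of Theorem M8, TeX l.24070–24300; KlainermanSzeftel2023, §9.4.3 proof of Theorem M8, HAL hal-04280491 p. 616 L5 – p. 622 L76 (= e-print)] -/
def M8ofPT (K : LesConstants) (S : Setting c) : Prop :=
  ∀ (X X' : S.M) (u : ℝ), InU S u X → IsM7Extension K S X X' →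
  PTBound K S X' → NSup S X' c.klarge ≤ K.cM8 * c.ε0

/-- Theorem M8 from its chapter-9 sub-nodes (pure logic).  PROVED.
[cite: KlainermanSzeftel2021, §9.4.3–9.4.4, TeX l.24070–24319; KlainermanSzeftel2023, §9.4.3–9.4.4, HAL hal-04280491 p. 616–623 (= e-print up to the (9.4.20) preamble)] -/
theorem thmM8_of_ch9 (hPT : MainPT K S) (hBA : BAPTonExtension K S) (h8 : M8ofPT K S) :
    ThmM8 K S :=
  fun hidl X X' u hX hX' => h8 X X' u hX hX' (hPT hidl X X' u hX hX' (hBA X X' u hX hX'))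

/-! ### Inside the Main PT-Theorem: KS §9.4.5–9.4.8 -/

/-- **Theorem M0-PT** (KS Theorem 9.4.12, l.24330–24340), verbatim:
"Assume that the initial data layer `𝓛0` … satisfies `𝓘_{k_large+10} ≤ ε0, ^(ext)𝓘_3 ≤ ε0²`.
Then, under the bootstrap assumptions BA-PT, relative to the initial data norms … for the PT frames
of `ℳ`, we have `𝓘^PT_k ≲ ε0, k ≤ k_large+7`."  Hypothesis node.  `[J]` Theorem 9.4.12 (9.4.22),
HAL hal-04280491 p. 623 L25–32 (footnote 13, L35–36: "Sharper in terms of derivatives. Indeed, the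
conclusions of Theorem M0 hold for `k ≤ k_large − 2` while the ones of Theorem M0-PT hold for `k ≤
k_large + 7`", = e-print): verbatim the same; stated under BA-PT in both versions; proof `[J]` §9.5.
[cite: KlainermanSzeftel2021, Theorem 9.4.12 M0-PT, TeX l.24330–24340; KlainermanSzeftel2023, Theorem 9.4.12 (9.4.22), HAL hal-04280491 p. 623 L25–32 (= e-print)] -/
def ThmM0PT (K : LesConstants) (S : Setting c) : Prop := IDLWeak S → ∀ X' : S.M, BA_PT S X' →
  ∀ k : ℕ, k ≤ c.klarge + 7 → S.idlPT X' k ≤ K.cPT * c.ε0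

/-- **Lemma 9.4.13** (l.24355–24360 with Remark 9.4.14 l.24467–24473 and Step 1 l.24611):
"`𝔖_{k_small−1} + ℜ_{k_small−1} ≲ ε0`", hence the iteration assumption (l.24447–24450) holds for
`J = k_small − 1`.  Its proof (l.24363) uses the decay delivered by Theorem M7.  Hypothesis node.
JOURNAL (`[J]` Lemma 9.4.13, HAL hal-04280491 p. 624 L4–29): (9.4.23) = this display verbatim (L4–6), and
`[J]` ADDS (9.4.24) (L7–27): "In addition, we have, for `k ≤ k_small − 1`, `sup_{ℳ^(ext) ∪ ℳ^(top)′(r ≥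
r0)} {(r u^{1/2+δdec} + u^{1+3δdec/4})|𝔡^{≤k}Γ_g| + r u^{1+3δdec/4}|𝔡^{≤k}Γ_b|} + sup_{ℳ^(top)′(r ≤ r0) ∪
ℳ^(int)′} u^{1+3δdec/4}{|𝔡^{≤k}Γ_g| + |𝔡^{≤k}Γ_b|} ≲ ε0`" (PT Ricci coefficients; under-bars of `u̲` not
rendered in the text layer) — sup bounds of the kind the e-print displayed only inside the proof
(l.24365–24423) are promoted to the statement, at the rate `u^{1+3δdec/4}` (the cell's GAPS.md K20b; rates
typed in `RefereedRateCount`); the proof still opens "in view of Theorem M7" (p. 624 L30).  `[J]` Remark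
9.4.14 (p. 627 L8–10: "In view of (9.4.23), i.e. `𝔊_{k_small−1} + ℜ_{k_small−1} ≲ ε0`, (9.4.35) holds for
`J = k_small − 1`") and §9.4.8 Step 1 (p. 629 L36–37: "As mentioned in Remark 9.4.14, the estimate (9.4.23)
trivially implies the iteration assumption (9.4.35) with `J = k_small − 1`") = e-print l.24467–24473,
l.24611.  v2 splits this node as print does: `Lemma9413` ((9.4.23) itself, with a bound) and
`IterBaseOfLow` (Remark 9.4.14 / Step 1), `iterBase_of_lemma9413` recovering this node.
[cite: KlainermanSzeftel2021, Lemma 9.4.13, TeX l.24355–24363; KlainermanSzeftel2023, Lemma 9.4.13 (9.4.23)–(9.4.24) with Remark 9.4.14 and §9.4.8 Step 1, HAL hal-04280491 p. 624 L4–30, p. 627 L8–10, p. 629 L36–37 ((9.4.23) = e-print; (9.4.24) new)] -/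
def IterBase (K : LesConstants) (S : Setting c) : Prop :=
  ∀ (X X' : S.M) (u : ℝ), InU S u X → IsM7Extension K S X X' →
  BA_PT S X' → S.iter X' (c.ksmall - 1)

/-- **Iteration step** (KS §9.4.8 Step 2, l.24613–24626, from Corollary 9.4.21 l.24549–24564,
itself from Theorem 9.4.15 [= GKS, curvature; KS l.24481–24492 "will be proved in a separate
paper"] and Propositions 9.4.17–9.4.20, l.24496–24546): for `k_small − 1 ≤ J ≤ k_large + 5`, the
iteration assumption (l.24447–24450) at `J` implies it at `J+1` ("where the constant in `≲`
depends on `r0`").  The content of the step (FORM A of KS v1 vs FORM B of GKS 13.6.3) is kept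
opaque here (`S.iter`).  Hypothesis node.
JOURNAL (`[J]` §9.4.8 Step 2, HAL hal-04280491 p. 629 L38 – p. 630 L25): the same induction, "for `|a|`
small enough" (p. 630 L18), (9.4.47)–(9.4.48); its inputs renumbered by −1: Corollary 9.4.20 (p. 628 L15 –
p. 629 L34; e-print 9.4.21), Propositions 9.4.16–9.4.19 (p. 627 L64 – p. 628 L14; e-print 9.4.17–9.4.20),
and Theorem 9.4.15 (p. 627 L13–63) now stated in the GKS form and discharged in `[J]` §9.6 from Theorem
9.6.7 (p. 653 L2: "Let `J` such that `J ≤ k_large + 6`"; Remark 9.6.8, p. 653 L60: "Theorem 9.6.7 is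
proved in a separate paper, see Theorem 13.6.3 in [28]") — GKS printing the range `k_L/2 ≤ J ≤ k_L − 1`
for its Theorem 13.6.3 (the cell's GAPS.md G-1; level ranges typed in `JunctionLevels`, `JFloorUses`).
`[J]` states Step 2, like the whole of §9.4.7–9.4.8, for the spacetime `ℳ` of Theorem M7 (Lemma
9.4.13's proof, p. 624 L30); the M7-restricted form of this node is `IterStepM7` (section `Journal`),
implied by this one.
[cite: KlainermanSzeftel2021, §9.4.8 Step 2 via Corollary 9.4.21, TeX l.24613–24626; KlainermanSzeftel2023, §9.4.8 Step 2 via Corollary 9.4.20, Theorem 9.4.15, Props 9.4.16–9.4.19, HAL hal-04280491 p. 627 L13 – p. 630 L25 (= e-print up to renumbering and the GKS form of Thm 9.4.15)] -/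
def IterStep (S : Setting c) : Prop := ∀ (X' : S.M), IDLWeak S → BA_PT S X' →
  ∀ J : ℕ, c.ksmall - 1 ≤ J → J ≤ c.klarge + 5 → S.iter X' J → S.iter X' (J + 1)

/-- **Top-order closure** (KS §9.4.8 Steps 3–4, l.24633–24740: interpolation Lemma 9.4.22, the
Lebesgue-point choice of `u_*'` (l.23585–23589), Corollary 9.4.21 at `J = k_large+6`, absorption for
`r0` large and `ε0` small): the iteration assumption at `J = k_large + 6` together with BA-PT and
Theorem M0-PT's conclusion gives `𝔖_k + ℜ_k ≲ ε0` for all `k ≤ k_large + 7`.  Hypothesis node.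
JOURNAL (`[J]` §9.4.8 Steps 3–4, HAL hal-04280491 p. 630 L26 – p. 635 L27): the interpolation lemma is
`[J]` Lemma 9.4.21 (9.4.49) (p. 630 L28–34; e-print Lemma 9.4.22) and GAINS `ε0` summands — "`L_*(k) ≲
(ε0 + L_*(k_small−1))^{…}(ε0 + ℜ_{k_large+7} + L_*(k_large+7))^{…}`" (the cell's GAPS.md E17b, resolved in
print); the slice choice is `[J]` (9.2.7) (p. 606 L21–46, recalled p. 634 L2–26) with the infimum over
`u_* − 5 ≤ u₁ ≤ u_* − 4` (e-print l.23585–23590: `[u_* − 2, u_* − 1]`; a unit-length window either way);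
Step 4 (p. 633 L16ff) invokes (9.4.23) for "`L_*(k_small−1) ≲ ε0`" (p. 633 L23–24), takes "for `r0`
large enough" (p. 634 L54–55) and "For `|a|` small enough" (p. 634 L65) and concludes (9.4.14) at p. 635
L25–27 — otherwise verbatim the e-print.  M7-restricted form (with the (9.4.23) bound as an explicit input, as Step 4 uses
it): `IterTopM7` (section `Journal`), implied by this one.
[cite: KlainermanSzeftel2021, §9.4.8 Steps 3–4 with Lemma 9.4.22, TeX l.24633–24740; KlainermanSzeftel2023, §9.4.8 Steps 3–4 with Lemma 9.4.21 (9.4.49) and (9.2.7), HAL hal-04280491 p. 630 L26 – p. 635 L27 and p. 606 L21–46 (Δ: ε0 summands in (9.4.49); window of (9.2.7))] -/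
def IterTop (K : LesConstants) (S : Setting c) : Prop := ∀ (X' : S.M), IDLWeak S → BA_PT S X' →
  (∀ k : ℕ, k ≤ c.klarge + 7 → S.idlPT X' k ≤ K.cPT * c.ε0) →
  S.iter X' (c.klarge + 6) → PTBound K S X'

variable {K S}

/-- The induction of KS §9.4.8 Step 2 (l.24626–24631): from the iteration assumption at
`J = k_small − 1` and the step for `k_small − 1 ≤ J ≤ k_large + 5`, it holds at `J = k_large + 6`.
Pure logic; the only arithmetic fact used is `k_small − 1 ≤ k_large + 6` (true since
`k_small = ⌊k_large/2⌋+1`).  PROVED.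
[cite: KlainermanSzeftel2021, §9.4.8 Step 2 induction on J, TeX l.24626–24631; KlainermanSzeftel2023, §9.4.8 Step 2 (9.4.47)–(9.4.48), HAL hal-04280491 p. 630 L20–25 (= e-print)] -/
theorem iter_to_top (X' : S.M) (hbase : S.iter X' (c.ksmall - 1))
    (hstep : ∀ J : ℕ, c.ksmall - 1 ≤ J → J ≤ c.klarge + 5 → S.iter X' J → S.iter X' (J + 1)) :
    S.iter X' (c.klarge + 6) := by
  have hks : c.ksmall - 1 ≤ c.klarge + 6 := by unfold Constants.ksmall; omega
  -- induct on the distance n from k_small - 1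
  have key : ∀ n : ℕ, c.ksmall - 1 + n ≤ c.klarge + 6 → S.iter X' (c.ksmall - 1 + n) := by
    intro n
    induction n with
    | zero => intro _; simpa using hbase
    | succ n ih =>
      intro hn
      have h' : S.iter X' (c.ksmall - 1 + n) := ih (by omega)
      have := hstep (c.ksmall - 1 + n) (by omega) (by omega) h'
      simpa [Nat.add_assoc] using this
  have := key (c.klarge + 6 - (c.ksmall - 1)) (by omega)
  have e : c.ksmall - 1 + (c.klarge + 6 - (c.ksmall - 1)) = c.klarge + 6 := by omega
  rw [e] at this
  exact this

/-- The Main PT-Theorem from its sub-nodes M0-PT, Lemma 9.4.13, the iteration step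
(Cor. 9.4.21 ⇐ Thm 9.4.15 [GKS] + Props 9.4.17–9.4.20) and the top-order closure (pure logic).
PROVED. [cite: KlainermanSzeftel2021, §9.4.8 end of the proof of Theorem 9.4.10, TeX l.24606–24745; KlainermanSzeftel2023, §9.4.8, HAL hal-04280491 p. 629 L35 – p. 635 L27 (= e-print up to renumbering)] -/
theorem mainPT_of_subnodes (h0 : ThmM0PT K S) (hb : IterBase K S) (hs : IterStep S)
    (ht : IterTop K S) : MainPT K S := by
  intro hidl X X' u hX hX' hBA
  have hbase := hb X X' u hX hX' hBA
  have htop : S.iter X' (c.klarge + 6) := iter_to_top X' hbase (hs X' hidl hBA)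
  exact ht X' hidl hBA (h0 hidl X' hBA) htop

end Ch9

/-! ## Chapter 8: the sub-DAG of Theorem M7 (KS §8.9, l.21593–23053) -/

section Ch8
variable (K : LesConstants) (S : Setting c)

/-- Opaque intermediate objects of the proof of Theorem M7 ("The proof of Theorem M7 proceeds in
18 steps", KS l.21599–21610).  Field ↦ KS steps:
* `Ext` — the type of extended spacetimes `ℳ^(extend)`; `IsExtension X E` — output of Steps 1–5
  (l.21627–21977): "we use local existence to extend the spacetime `ℳ` a little bit, and then
  focus on the region in the future of `Σ_*` in which we derive additional estimates"; Step 1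
  (l.21631–21635) is "a local existence argument" giving `𝔑^(Dec)_{k_*−3}(ℳ^(extend)) ≤ 2Cε0`,
  `k_* = k_small + 20`; Step 2 (l.21637) invokes Shen, Theorem 4.1 (arXiv:2205.12336) to extend
  `Σ_*`; Step 5 (l.21799ff) uses KS-GCM2 Definition 3.10 / "Proposition 4.15" (arXiv:1912.12195);
* `HasNewSlice E` — output of Steps 6–13 (l.21978–22347): a new last sphere `S̃_*` (Step 6,
  l.21990: Theorem 7.3 and Corollary 7.7 of KS-GCM2) and a new last slice `Σ̃_*` (Step 7, l.22010:
  Theorem 4.1 of Shen), which extends all the way to the initial data layer (Steps 8–11,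
  l.22047–22269, "by a continuity argument based on reapplying Theorem 4.1 in [Shen]", l.22073),
  satisfies the dominance condition (Step 12, l.22270–22300) and all properties required of the
  future spacelike boundary of a GCM admissible spacetime, with `ũ(S̃_*) > u_*` (Step 13,
  l.22302–22347);
* `NewSpacetime E X'` — output of Steps 14–18 (l.22352–23053): the new GCM admissible spacetime
  `X' = ℳ̃ = ^(ext)ℳ̃ ∪ ^(int)ℳ̃ ∪ ^(top)ℳ̃` (l.23041–23043) built on `Σ̃_*`, with the frame-change
  control, `|m̃ − m| + |ã − a| ≲ ε0` (l.22970–22972) and `𝔑^(Dec)_{k_small}(ℳ̃) ≲ ε0`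
  (l.23046–23053).
A bookkeeping carrier.  `[J]` §8.5 (e-print §8.9), HAL hal-04280491 p. 551 L2–28: the same 18-step
summary verbatim (`k_* := k_small + 20` (8.5.1) L23; `ℳ ∈ ℵ(u_*)`, `𝔑^(Dec)_{k_*}(ℳ) ≤ Cε0` (8.5.2)
L24–28); Step 1 p. 552 L3–7; Step 2 p. 552 L8–11 ("Theorem 4.1 in [50] (restated here in Theorem
8.1.11)"); Step 6 p. 562 L3, L53–54 ("Theorem 7.3 and Corollary 7.7 of [41] (restated here in Theorem
8.1.7 and Corollary 8.1.8)"); Step 7 p. 562 L77–78; Steps 8–11 p. 564 L2 – p. 569 ("reapplying Theorem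
4.1 in [50]", p. 564 L40); Step 12 p. 569 L48; Step 13 p. 570 L89 – p. 571 ((8.5.40) `ũ(S̃_*) > u_*`);
Steps 14–18 p. 572 L3 – p. 592 L53 ((8.5.63) p. 590 L40–59 with `|m̃ − m| + |ã − a| ≲ ε0`;
"`𝔑^(Dec)_{k_small}(ℳ̃) ≲ ε0` which concludes the proof of Theorem M7" p. 592 L44–53).
[cite: KlainermanSzeftel2021, §8.9 the 18 steps of Theorem M7, TeX l.21599–21610; KlainermanSzeftel2023, §8.5 the 18 steps of Theorem M7, HAL hal-04280491 p. 551 L2–28 (= e-print)] -/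
structure M7Objects (S : Setting c) where
  Ext : Type
  IsExtension : S.M → Ext → Prop
  HasNewSlice : Ext → Prop
  NewSpacetime : Ext → S.M → Prop

variable (O : M7Objects S)

/-- M7 Steps 1–5 (KS l.21627–21977): local-existence extension of `X ∈ ℵ(u_*)` with
`𝔑^(Dec)_{k_small+20}(X) ≤ C ε0` (l.21617–21622) and control of the region to the future of
`Σ_*`.  External input: Shen Thm 4.1 (Step 2).  Hypothesis node.  `[J]` §8.5 Steps 1–5, HAL
hal-04280491 p. 552 L3 – p. 561: = e-print.
[cite: KlainermanSzeftel2021, §8.9 Steps 1–5, TeX l.21627–21977; KlainermanSzeftel2023, §8.5 Steps 1–5, HAL hal-04280491 p. 552–561 (= e-print)] -/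
def M7Extend (K : LesConstants) (S : Setting c) (O : M7Objects S) : Prop :=
  IDLWeak S → ∀ (X : S.M) (u : ℝ), 0 < u → InU S u X →
  ImprovedDecay K S X → ∃ E : O.Ext, O.IsExtension X E

/-- M7 Steps 6–13 (KS l.21978–22347): new last sphere and new last slice in the extended region,
reaching the initial data layer, with the dominance condition and `ũ(S̃_*) > u_*`.  External
inputs: KS-GCM2 Thm 7.3 / Cor 7.7 (arXiv:1912.12195), Shen Thm 4.1 (arXiv:2205.12336).
Hypothesis node.  `[J]` §8.5 Steps 6–13, HAL hal-04280491 p. 562 L3 – p. 571: = e-print (inputs cited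
as `[J]` Theorem 8.1.7 / Corollary 8.1.8 and Theorem 8.1.11).
[cite: KlainermanSzeftel2021, §8.9 Steps 6–13, TeX l.21978–22347; KlainermanSzeftel2023, §8.5 Steps 6–13, HAL hal-04280491 p. 562–571 (= e-print)] -/
def M7NewSlice (S : Setting c) (O : M7Objects S) : Prop :=
  ∀ (X : S.M) (E : O.Ext), O.IsExtension X E → O.HasNewSlice E

/-- M7 Steps 14–18 (KS l.22352–23053): the new GCM admissible spacetime `ℳ̃` on `Σ̃_*` with all the
`IsM7Extension` properties (the `param` field via `param_bookkeeping`).  Hypothesis node.  `[J]` §8.5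
Steps 14–18, HAL hal-04280491 p. 572 L3 – p. 592 L53: = e-print.
[cite: KlainermanSzeftel2021, §8.9 Steps 14–18, TeX l.22352–23053; KlainermanSzeftel2023, §8.5 Steps 14–18, HAL hal-04280491 p. 572–592 (= e-print)] -/
def M7Assemble (K : LesConstants) (S : Setting c) (O : M7Objects S) : Prop :=
  IDLWeak S → ∀ (X : S.M) (u : ℝ), InU S u X → ∀ E : O.Ext,
  O.IsExtension X E → O.HasNewSlice E → ∃ X' : S.M, O.NewSpacetime E X' ∧ IsM7Extension K S X X'

variable {K S O}

/-- Theorem M7 from its chapter-8 sub-nodes (pure logic).  PROVED.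
[cite: KlainermanSzeftel2021, §8.9 proof of Theorem M7, TeX l.21593–23053; KlainermanSzeftel2023, §8.5 proof of Theorem M7, HAL hal-04280491 p. 551–592 (= e-print)] -/
theorem thmM7_of_ch8 (h1 : M7Extend K S O) (h2 : M7NewSlice S O) (h3 : M7Assemble K S O) :
    ThmM7 K S := by
  intro hidl X u hu hX hdec
  obtain ⟨E, hE⟩ := h1 hidl X u hu hX hdec
  obtain ⟨X', -, hX'⟩ := h3 hidl X u hX E hE (h2 X E hE)
  exact ⟨X', hX'⟩

end Ch8

/-! ## Dependency variants recorded in the KS introduction (the DAG edges M1,M2 → M3 → M4 → M5) -/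

section Deps
variable (K : LesConstants) (S : Setting c)

/-- KS intro l.1520: "Theorem M3 … makes use of the improved estimates for `α`, `α̲`, and `𝔮` of
Theorems M1 and M2".  Proof-structure form of M3: BA + conclusions of M1, M2 for `X` ⇒ `^*𝔇`.
Hypothesis node.  `[J]` intro, HAL hal-04280491 p. 43 L28–30: the same sentence; with `[J]`'s Theorem M2
the M2-input is the `Σ_*`-flux alone — journal edge `ThmM3fromM1M2J` (section `Journal`), which implies
this one (`thmM3fromM1M2_of_J`).
[cite: KlainermanSzeftel2021, §1 outline of Theorem M3, TeX l.1520–1521; KlainermanSzeftel2023, §1 outline of Theorem M3, HAL hal-04280491 p. 43 L28–30 (= e-print; M2-input per [J] Theorem M2 in ThmM3fromM1M2J)] -/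
def ThmM3fromM1M2 (K : LesConstants) (S : Setting c) : Prop :=
  IDLWeak S → ∀ X : S.M, BA_B S X → BA_D S X →
  (∃ δextra : ℝ, c.δdec < δextra ∧ S.m1Sup X δextra ≤ K.cM1 * c.ε0 ∧
    S.m1Flux X δextra ≤ (K.cM1 * c.ε0) ^ 2 ∧ S.m1A X δextra ≤ K.cM1 * c.ε0) →
  (S.m2Dec X ≤ K.cM2 * c.ε0 ∧ S.m2Flux X ≤ (K.cM2 * c.ε0) ^ 2) →
  S.starD X (c.ksmall + 60) ≤ K.cM3 * c.ε0

/-- KS intro l.1542–1543: "Theorem M4 … extends the estimates of Theorem M3 on `Σ_*` to the entire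
region `ℳ^(ext)`".  Hypothesis node.  `[J]` intro, HAL hal-04280491 p. 44 L14–16: the same sentence.
[cite: KlainermanSzeftel2021, §1 outline of Theorem M4, TeX l.1542–1543; KlainermanSzeftel2023, §1 outline of Theorem M4, HAL hal-04280491 p. 44 L14–16 (= e-print)] -/
def ThmM4fromM3 (K : LesConstants) (S : Setting c) : Prop :=
  IDLWeak S → ∀ X : S.M, BA_B S X → BA_D S X →
  S.starD X (c.ksmall + 60) ≤ K.cM3 * c.ε0 → S.extD X (c.ksmall + 40) ≤ K.cM4 * c.ε0

/-- KS intro l.1559–1560: Theorem M5 "first control[s] the foliation of `ℳ^(int)` and `ℳ^(top)`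
from the one of `ℳ^(ext)` respectively on `𝒯` and `{u = u_*}`" — i.e. uses Theorem M4.
Hypothesis node.  `[J]` intro, HAL hal-04280491 p. 45 L5–10: the same sentence; and in `[J]` the
`ℳ^(int)`/`ℳ^(top)` decay of `A̲` (e-print: Theorem M2's first clause, invoked at l.17359–17362,
l.17780) is derived inside ch. 7 from exactly this input: Prop. 7.3.1 (7.3.1), p. 427 L17–30 (the control
of `A̲` on `𝒯` from Lemma 7.2.2, propagated into `ℳ^(int)` with the Teukolsky–Starobinsky formula of
"Proposition 5.4.1 of [28]"), and Prop. 7.6.1 (7.6.1), p. 447, on `ℳ^(top)` from `{u = u_*}` (Lemma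
7.5.3, p. 449 L21–22); so this edge's hypothesis list is the journal's.
[cite: KlainermanSzeftel2021, §1 outline of Theorem M5, TeX l.1559–1560; KlainermanSzeftel2023, §1 outline of Theorem M5 and Props 7.3.1/7.6.1, HAL hal-04280491 p. 45 L5–10, p. 427 L17–21, p. 447 (= e-print edge; A̲-decay now internal to ch. 7)] -/
def ThmM5fromM4 (K : LesConstants) (S : Setting c) : Prop :=
  IDLWeak S → ∀ X : S.M, BA_B S X → BA_D S X →
  S.extD X (c.ksmall + 40) ≤ K.cM4 * c.ε0 →
  S.intD X (c.ksmall + 20) + S.topD X (c.ksmall + 20) ≤ K.cM5 * c.ε0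

variable {K S}

/-- Theorem M3 from M1, M2 and the edge `ThmM3fromM1M2` (pure logic).  PROVED.
[cite: KlainermanSzeftel2021, §1 outline of Theorem M3, TeX l.1520–1521] -/
theorem thmM3_of_M1_M2 (h1 : ThmM1 K S) (h2 : ThmM2 K S) (h : ThmM3fromM1M2 K S) : ThmM3 K S :=
  fun hidl X hB hD => h hidl X hB hD (h1 hidl X hB hD) (h2 hidl X hB hD)

/-- Theorem M4 from M3 and the edge `ThmM4fromM3` (pure logic).  PROVED.
[cite: KlainermanSzeftel2021, §1 outline of Theorem M4, TeX l.1542–1543] -/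
theorem thmM4_of_M3 (h3 : ThmM3 K S) (h : ThmM4fromM3 K S) : ThmM4 K S :=
  fun hidl X hB hD => h hidl X hB hD (h3 hidl X hB hD)

/-- Theorem M5 from M4 and the edge `ThmM5fromM4` (pure logic).  PROVED.
[cite: KlainermanSzeftel2021, §1 outline of Theorem M5, TeX l.1559–1560] -/
theorem thmM5_of_M4 (h4 : ThmM4 K S) (h : ThmM5fromM4 K S) : ThmM5 K S :=
  fun hidl X hB hD => h hidl X hB hD (h4 hidl X hB hD)

/-- **The whole typed chain at leaf resolution**: Main Theorem v2 from M1, M2, the proof-structure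
forms of M3–M5, M6, the ch.-8 sub-nodes of M7, the ch.-9 sub-nodes of M8 (incl. the undischarged
`BAPTonExtension`), `FlowClosed`, `LimitExists`, `ThmConclusions`, admissible constants with
explicit `ε0`-thresholds, and the norm-comparison `^(ext)𝓘_3 ≤ 𝓘_{k_large+10}` — 25 explicit
hypotheses, every analytic input among them.  PROVED.  (Journal-shape variant:
`mainTheorem_of_leaves_J`, section `Journal`.)
[cite: KlainermanSzeftel2021, Main Theorem version 2 from Theorems M0–M8, TeX l.6640–6856] -/
theorem mainTheorem_of_leaves {O : M7Objects S} (hc : c.Admissible) (hε0 : c.ε0 < 1)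
    (hext : S.idlExt3 ≤ S.idl (c.klarge + 10))
    (h87 : 0 < K.cM8 + K.cM7) (h7 : 0 < K.cM7)
    (hs1 : c.ε0 ≤ ((K.cM8 + K.cM7)⁻¹) ^ (3 : ℕ)) (hs2 : c.ε0 ≤ (K.cM7⁻¹) ^ (3 : ℕ))
    (hM1 : ThmM1 K S) (hM2 : ThmM2 K S) (hM3 : ThmM3fromM1M2 K S) (hM4 : ThmM4fromM3 K S)
    (hM5 : ThmM5fromM4 K S) (hM6 : ThmM6 S)
    (h71 : M7Extend K S O) (h72 : M7NewSlice S O) (h73 : M7Assemble K S O)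
    (hM0PT : ThmM0PT K S) (hIb : IterBase K S) (hIs : IterStep S) (hIt : IterTop K S)
    (hBAPT : BAPTonExtension K S) (h8PT : M8ofPT K S)
    (hflow : FlowClosed S) (hlim : LimitExists K S) (hconcl : ThmConclusions K S) :
    MainTheoremV2 K S :=
  have hM3' : ThmM3 K S := thmM3_of_M1_M2 hM1 hM2 hM3
  have hM4' : ThmM4 K S := thmM4_of_M3 hM3' hM4
  have hM5' : ThmM5 K S := thmM5_of_M4 hM4' hM5
  mainTheorem_of_nodes hc hε0 hext hM3' hM4' hM5' hM6 (thmM7_of_ch8 h71 h72 h73)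
    (thmM8_of_ch9 K S (mainPT_of_subnodes hM0PT hIb hIs hIt) hBAPT h8PT) hflow
    (smallEps_of_admissible K hc h87 h7 hs1 hs2) hlim hconcl

end Deps

/-! ## v2 — JOURNAL SHAPES (`[J]` = the refereed version, bib key `KlainermanSzeftel2023`, read in the
authors' accepted manuscript HAL hal-04280491; locators `HAL p. N Lm`)

Additive only: the e-print shapes above are kept verbatim for the importing modules.  Each journal shape
comes with the implication from its e-print counterpart (the journal statements are sub-statements of the
e-print ones, or the e-print nodes specialised to the spacetime of Theorem M7), and
`mainTheorem_of_leaves_J` re-runs the leaf-resolution certificate from the journal shapes.  As everywhere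
in this file these are STATEMENT SHAPES over the abstract carrier — hypothesis nodes, never asserted. -/

section Journal
variable (K : LesConstants) (S : Setting c)

/-- Shadow of the REFEREED first constraint of (3.4.1): `[J]` (HAL hal-04280491 p. 140 L3) reads
"`0 < δH, δdec, δB, δ_* ≪ min{m0 − |a0|, 1}`" where the e-print (TeX l.6077) had `min{m0, 1}` — the only
change in §3.4.1 between the two versions.  `≪` has no typed meaning; recorded, like the other shadows
of `Constants.Admissible`, as the strict inequality `max{δH, δdec, δB, δ_*} < min{m0 − |a0|, 1}`.  An
explicit predicate consumed by nothing in this file (the continuity argument uses no relation among the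
`δ`'s); deliberately NOT a field of `Constants.Admissible` (kept in its e-print shape for the importing
modules).
[cite: KlainermanSzeftel2023, eq. (3.4.1) first line, HAL hal-04280491 p. 140 L3; KlainermanSzeftel2021, eq. (3.4.1), TeX l.6077 (min{m0, 1})] -/
def Constants.DeltaGapJ (c : Constants) : Prop :=
  max (max c.δH c.δdec) (max c.δB c.δstar) < min (c.m0 - |c.a0|) 1

/-- **Theorem M2, journal shape** (`[J]` Theorem M2, HAL hal-04280491 p. 158 L2–9), verbatim: "Under the
same assumptions as above, we have the following estimate for `α̲` on `Σ_*`, with respect to the global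
frame of Proposition 3.6.11, `max_{0≤k≤k_small+80} ∫_{Σ_*} u^{2+2δ_dec}|𝔡^kα̲|² ≲ ε0²`."  = the second
clause of the e-print's Theorem M2 (`ThmM2`); the e-print's first clause (`^(int)𝔇 + ^(top)𝔇 ≲ ε0`) is
not part of the refereed statement.  Proved in "Part II of [28]" (`[J]` §3.9, p. 183 L22–23).
Hypothesis node; implied by `ThmM2` (`thmM2J_of_thmM2`).
[cite: KlainermanSzeftel2023, Theorem M2, HAL hal-04280491 p. 158 L2–9; KlainermanSzeftel2021, Theorem M2 second clause, TeX l.6695–6697] -/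
def ThmM2J (K : LesConstants) (S : Setting c) : Prop := IDLWeak S → ∀ X : S.M, BA_B S X → BA_D S X →
  S.m2Flux X ≤ (K.cM2 * c.ε0) ^ 2

/-- The edge M1, M2 → M3 with the JOURNAL's Theorem M2: `[J]` intro (HAL hal-04280491 p. 43 L28–30 =
e-print l.1520) "Theorem M3 … makes use of the improved estimates for `α`, `α̲`, and `𝔮` of Theorems M1 and
M2", where `[J]`'s Theorem M2 (p. 158 L2–9) delivers the `Σ_*`-flux of `α̲` only — which is what a decay
estimate ON `Σ_*` (Theorem M3) can consume.  Proof-structure form of M3 with the M2-input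
`S.m2Flux X ≤ (cM2 ε0)²` alone; a stronger node than `ThmM3fromM1M2` (fewer hypotheses:
`thmM3fromM1M2_of_J`).  Hypothesis node.
[cite: KlainermanSzeftel2023, §1 outline of Theorem M3 with Theorem M2, HAL hal-04280491 p. 43 L28–30 and p. 158 L2–9; KlainermanSzeftel2021, §1 outline of Theorem M3, TeX l.1520–1521] -/
def ThmM3fromM1M2J (K : LesConstants) (S : Setting c) : Prop :=
  IDLWeak S → ∀ X : S.M, BA_B S X → BA_D S X →
  (∃ δextra : ℝ, c.δdec < δextra ∧ S.m1Sup X δextra ≤ K.cM1 * c.ε0 ∧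
    S.m1Flux X δextra ≤ (K.cM1 * c.ε0) ^ 2 ∧ S.m1A X δextra ≤ K.cM1 * c.ε0) →
  S.m2Flux X ≤ (K.cM2 * c.ε0) ^ 2 →
  S.starD X (c.ksmall + 60) ≤ K.cM3 * c.ε0

/-- **Lemma 9.4.13, display (9.4.23)** (`[J]` HAL hal-04280491 p. 624 L4–6 = e-print Lemma 9.4.13
l.24355–24360), verbatim: "Relative to the global norms defined in Section 9.4.1 for the PT frames of `ℳ`,
we have the following bounds `𝔊_{k_small−1} + ℜ_{k_small−1} ≲ ε0`" — stated inside the proof of Theorem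
9.4.10 (hence under BA-PT, §9.4.4) for the spacetime `ℳ` whose "PG structures … satisfy in view of
Theorem M7" the decay `𝔑^(Dec)_{k_small} ≲ ε0` (proof, p. 624 L30 = l.24363; (9.4.25)).  Typed with
the quantifiers the print context supplies (`X'` = the spacetime exhibited in Theorem M7 from some
`X ∈ 𝒰(u)`) and the constant `cPT` (see `LesConstants`).  `[J]` adds to the lemma the sup-decay display
(9.4.24) (p. 624 L7–27), not typed here (its rates are the subject of the cell's `RefereedRateCount`).
The display is used twice downstream: as the base `J = k_small − 1` of the iteration (Remark 9.4.14,
Step 1: `IterBaseOfLow`) and in Step 4 for "`L_*(k_small−1) ≲ ε0`" (p. 633 L23–24: an input of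
`IterTopM7`).  Hypothesis node.
[cite: KlainermanSzeftel2023, Lemma 9.4.13 (9.4.23), HAL hal-04280491 p. 624 L4–6 and L30; KlainermanSzeftel2021, Lemma 9.4.13, TeX l.24355–24363] -/
def Lemma9413 (K : LesConstants) (S : Setting c) : Prop :=
  ∀ (X X' : S.M) (u : ℝ), InU S u X → IsM7Extension K S X X' →
  BA_PT S X' → S.ptNorm X' (c.ksmall - 1) ≤ K.cPT * c.ε0

/-- **Remark 9.4.14 / §9.4.8 Step 1** (`[J]` HAL hal-04280491 p. 627 L8–10: "In view of (9.4.23), i.e.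
`𝔊_{k_small−1} + ℜ_{k_small−1} ≲ ε0`, (9.4.35) holds for `J = k_small − 1`"; p. 629 L36–37: "As mentioned in
Remark 9.4.14, the estimate (9.4.23) trivially implies the iteration assumption (9.4.35) with `J = k_small
− 1`"; = e-print l.24467–24473, l.24611 with (9.4.22)/(9.4.33) for (9.4.23)/(9.4.35)): the bound (9.4.23)
implies the iteration assumption (9.4.35) `𝔊_J + ℜ_J ≲ ε0 + L_*(J)` at `J = k_small − 1`.  Trivial in print
(`L_*(J) ≥ 0`); an explicit node here because `S.iter` is opaque.  Hypothesis node.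
[cite: KlainermanSzeftel2023, Remark 9.4.14 and §9.4.8 Step 1, HAL hal-04280491 p. 627 L8–10 and p. 629 L36–37; KlainermanSzeftel2021, Remark 9.4.14 and §9.4.8 Step 1, TeX l.24467–24473 and l.24611] -/
def IterBaseOfLow (K : LesConstants) (S : Setting c) : Prop :=
  ∀ X' : S.M, S.ptNorm X' (c.ksmall - 1) ≤ K.cPT * c.ε0 → S.iter X' (c.ksmall - 1)

/-- **Iteration step, M7-restricted** — `IterStep` stated, as `[J]` §9.4.7–9.4.8 state it (HAL
hal-04280491 p. 626 L39 – p. 630 L25; the standing `ℳ` is the spacetime of Theorem M7, p. 624 L30), for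
the spacetime `X'` exhibited in Theorem M7 from some `X ∈ 𝒰(u)`: for `k_small − 1 ≤ J ≤ k_large + 5`,
(9.4.35) at `J` implies (9.4.35) at `J+1` ("for `|a|` small enough", p. 630 L18; via Corollary 9.4.20,
Theorem 9.4.15 [= GKS Theorem 13.6.3, `[J]` §9.6 Theorem 9.6.7] and Propositions 9.4.16–9.4.19).  Weaker
than `IterStep` (`iterStepM7_of_iterStep`); the content of the step stays opaque (`S.iter`).
Hypothesis node.
[cite: KlainermanSzeftel2023, §9.4.8 Step 2 via Corollary 9.4.20, HAL hal-04280491 p. 629 L38 – p. 630 L25; KlainermanSzeftel2021, §9.4.8 Step 2 via Corollary 9.4.21, TeX l.24613–24626] -/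
def IterStepM7 (K : LesConstants) (S : Setting c) : Prop :=
  ∀ (X X' : S.M) (u : ℝ), InU S u X → IsM7Extension K S X X' → IDLWeak S → BA_PT S X' →
  ∀ J : ℕ, c.ksmall - 1 ≤ J → J ≤ c.klarge + 5 → S.iter X' J → S.iter X' (J + 1)

/-- **Top-order closure, M7-restricted** — `IterTop` stated for the spacetime exhibited in Theorem M7
(`[J]` §9.4.8 Steps 3–4, HAL hal-04280491 p. 630 L26 – p. 635 L27), with the inputs Step 4 consumes made
explicit: (9.4.35) at `J = k_large + 6` ((9.4.48), p. 630 L24–25), the data bound of Theorem 9.4.12 (via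
Corollary 9.4.20's `ε̃_{J+1}`), BA-PT, AND (9.4.23) itself for "`L_*(k_small−1) ≲ ε0`" (p. 633 L23–24) — then
the
interpolation Lemma 9.4.21 (9.4.49), the slice choice (9.2.7), "for `r0` large enough" (p. 634 L54–55),
"For `|a|` small enough" (p. 634 L65) give (9.4.14): `𝔊_k + ℜ_k ≲ ε0, k ≤ k_large+7` (p. 635 L25–27).
Weaker than `IterTop` (`iterTopM7_of_iterTop`).  Hypothesis node.
[cite: KlainermanSzeftel2023, §9.4.8 Steps 3–4 with Lemma 9.4.21, HAL hal-04280491 p. 630 L26 – p. 635 L27; KlainermanSzeftel2021, §9.4.8 Steps 3–4 with Lemma 9.4.22, TeX l.24633–24740] -/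
def IterTopM7 (K : LesConstants) (S : Setting c) : Prop :=
  ∀ (X X' : S.M) (u : ℝ), InU S u X → IsM7Extension K S X X' → IDLWeak S → BA_PT S X' →
  (∀ k : ℕ, k ≤ c.klarge + 7 → S.idlPT X' k ≤ K.cPT * c.ε0) →
  S.ptNorm X' (c.ksmall - 1) ≤ K.cPT * c.ε0 →
  S.iter X' (c.klarge + 6) → PTBound K S X'

variable {K S}

/-- The e-print's Theorem M2 implies the journal's (drop the first clause).  PROVED (pure logic).
[cite: KlainermanSzeftel2023, Theorem M2, HAL hal-04280491 p. 158 L2–9; KlainermanSzeftel2021, Theorem M2, TeX l.6691–6697] -/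
theorem thmM2J_of_thmM2 (h : ThmM2 K S) : ThmM2J K S :=
  fun hidl X hB hD => (h hidl X hB hD).2

/-- The journal edge M1, M2J → M3 implies the e-print edge (it has fewer hypotheses).  PROVED.
[cite: KlainermanSzeftel2023, §1 outline of Theorem M3, HAL hal-04280491 p. 43 L28–30; KlainermanSzeftel2021, §1 outline of Theorem M3, TeX l.1520–1521] -/
theorem thmM3fromM1M2_of_J (h : ThmM3fromM1M2J K S) : ThmM3fromM1M2 K S :=
  fun hidl X hB hD h1 h2 => h hidl X hB hD h1 h2.2

/-- Theorem M3 from M1, the journal's M2 and the journal edge (pure logic).  PROVED.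
[cite: KlainermanSzeftel2023, §1 outline of Theorem M3 with Theorems M1, M2, HAL hal-04280491 p. 43 L28–30 and p. 157–158] -/
theorem thmM3_of_M1_M2J (h1 : ThmM1 K S) (h2 : ThmM2J K S) (h : ThmM3fromM1M2J K S) : ThmM3 K S :=
  fun hidl X hB hD => h hidl X hB hD (h1 hidl X hB hD) (h2 hidl X hB hD)

/-- The e-print node `IterBase` from the two print items it merges: (9.4.23) and Step 1.  PROVED.
[cite: KlainermanSzeftel2023, Lemma 9.4.13 (9.4.23) and §9.4.8 Step 1, HAL hal-04280491 p. 624 L4–6 and p. 629 L36–37] -/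
theorem iterBase_of_lemma9413 (h13 : Lemma9413 K S) (hlow : IterBaseOfLow K S) : IterBase K S :=
  fun X X' u hX hX' hBA => hlow X' (h13 X X' u hX hX' hBA)

/-- `IterStep` (every spacetime) implies its M7-restricted form.  PROVED (pure logic).
[cite: KlainermanSzeftel2023, §9.4.8 Step 2, HAL hal-04280491 p. 629 L38 – p. 630 L25] -/
theorem iterStepM7_of_iterStep (h : IterStep S) : IterStepM7 K S :=
  fun _ X' _ _ _ hidl hBA => h X' hidl hBA

/-- `IterTop` (every spacetime, without the (9.4.23) input) implies its M7-restricted form.  PROVED.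
[cite: KlainermanSzeftel2023, §9.4.8 Steps 3–4, HAL hal-04280491 p. 630 L26 – p. 635 L27] -/
theorem iterTopM7_of_iterTop (h : IterTop K S) : IterTopM7 K S :=
  fun _ X' _ _ _ hidl hBA hidlPT _ htop => h X' hidl hBA hidlPT htop

/-- The Main PT-Theorem from the journal-shaped sub-nodes: Theorem 9.4.12, Lemma 9.4.13 (9.4.23),
Step 1, the M7-restricted iteration step and top-order closure (pure logic + `iter_to_top`).  PROVED.
[cite: KlainermanSzeftel2023, §9.4.5–9.4.8 proof of Theorem 9.4.10, HAL hal-04280491 p. 623 L21 – p. 635 L27] -/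
theorem mainPT_of_subnodesJ (h0 : ThmM0PT K S) (h13 : Lemma9413 K S) (hlow : IterBaseOfLow K S)
    (hs : IterStepM7 K S) (ht : IterTopM7 K S) : MainPT K S := by
  intro hidl X X' u hX hX' hBA
  have hlowb := h13 X X' u hX hX' hBA
  have hbase : S.iter X' (c.ksmall - 1) := hlow X' hlowb
  have htop : S.iter X' (c.klarge + 6) := iter_to_top X' hbase (hs X X' u hX hX' hidl hBA)
  exact ht X X' u hX hX' hidl hBA (h0 hidl X' hBA) hlowb htop

/-- **The whole typed chain at leaf resolution, JOURNAL shapes**: as `mainTheorem_of_leaves`, with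
`[J]`'s Theorem M2 (`ThmM2J`) and edge `ThmM3fromM1M2J` in place of the e-print's, and the ch.-9
sub-nodes of Theorem 9.4.10 in their print-faithful M7-restricted forms (`Lemma9413`, `IterBaseOfLow`,
`IterStepM7`, `IterTopM7`) — 26 explicit hypotheses, every analytic input among them; every other node
consumed is verbatim the same in both versions (see the per-node tags).  PROVED.
[cite: KlainermanSzeftel2023, Main Theorem version 2 from Theorems M0–M8, HAL hal-04280491 p. 143 and p. 156–160; KlainermanSzeftel2021, Main Theorem version 2 from Theorems M0–M8, TeX l.6640–6856] -/
theorem mainTheorem_of_leaves_J {O : M7Objects S} (hc : c.Admissible) (hε0 : c.ε0 < 1)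
    (hext : S.idlExt3 ≤ S.idl (c.klarge + 10))
    (h87 : 0 < K.cM8 + K.cM7) (h7 : 0 < K.cM7)
    (hs1 : c.ε0 ≤ ((K.cM8 + K.cM7)⁻¹) ^ (3 : ℕ)) (hs2 : c.ε0 ≤ (K.cM7⁻¹) ^ (3 : ℕ))
    (hM1 : ThmM1 K S) (hM2 : ThmM2J K S) (hM3 : ThmM3fromM1M2J K S) (hM4 : ThmM4fromM3 K S)
    (hM5 : ThmM5fromM4 K S) (hM6 : ThmM6 S)
    (h71 : M7Extend K S O) (h72 : M7NewSlice S O) (h73 : M7Assemble K S O)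
    (hM0PT : ThmM0PT K S) (h13 : Lemma9413 K S) (hIb : IterBaseOfLow K S) (hIs : IterStepM7 K S)
    (hIt : IterTopM7 K S) (hBAPT : BAPTonExtension K S) (h8PT : M8ofPT K S)
    (hflow : FlowClosed S) (hlim : LimitExists K S) (hconcl : ThmConclusions K S) :
    MainTheoremV2 K S :=
  have hM3' : ThmM3 K S := thmM3_of_M1_M2J hM1 hM2 hM3
  have hM4' : ThmM4 K S := thmM4_of_M3 hM3' hM4
  have hM5' : ThmM5 K S := thmM5_of_M4 hM4' hM5
  mainTheorem_of_nodes hc hε0 hext hM3' hM4' hM5' hM6 (thmM7_of_ch8 h71 h72 h73)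
    (thmM8_of_ch9 K S (mainPT_of_subnodesJ hM0PT h13 hIb hIs hIt) hBAPT h8PT) hflow
    (smallEps_of_admissible K hc h87 h7 hs1 hs2) hlim hconcl

end Journal


/-! ## `ℝ≥0∞`-valued norms ↦ the `ℝ`-valued fields of `Setting` (used by the cell's `Bridge.lean`)

The cell's `Setup` module values the regional norms in `ℝ≥0∞`.  Instantiate `Setting.starB X k :=
trunc (𝓜.BStar k)` etc.: `trunc` is monotone and non-negative, and since every threshold of the
skeleton is `≤ ε < 1` (`Constants.Admissible.ε_lt_one`), `trunc_le_iff` / `trunc_add_four_le_iff`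
transport each bound verbatim. -/

section SetupBridge
open scoped ENNReal

/-- Truncated real value of an `ℝ≥0∞`-valued quantity: `trunc x = (min x 1).toReal`.  A reading
device (not a notion of the source). [folklore] -/
def trunc (x : ℝ≥0∞) : ℝ := (min x 1).toReal

/-- `min x 1` is finite in `ℝ≥0∞`. [folklore] -/
theorem min_one_ne_top (x : ℝ≥0∞) : min x 1 ≠ ⊤ :=
  ne_top_of_le_ne_top ENNReal.one_ne_top (min_le_right _ _)

/-- `0 ≤ trunc x`. [folklore] -/
theorem trunc_nonneg (x : ℝ≥0∞) : 0 ≤ trunc x := ENNReal.toReal_nonneg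

/-- `trunc x ≤ 1`. [folklore] -/
theorem trunc_le_one (x : ℝ≥0∞) : trunc x ≤ 1 := by
  unfold trunc
  have := ENNReal.toReal_mono ENNReal.one_ne_top (min_le_right x 1)
  simpa using this

/-- `trunc` is monotone. [folklore] -/
theorem trunc_mono : Monotone trunc := fun _ y h =>
  ENNReal.toReal_mono (min_one_ne_top y) (min_le_min h le_rfl)

/-- For thresholds `0 ≤ t < 1` (all thresholds of the skeleton are `≤ ε < 1`), `trunc x ≤ t` is
equivalent to `x ≤ ENNReal.ofReal t`. [folklore] -/
theorem trunc_le_iff {x : ℝ≥0∞} {t : ℝ} (ht0 : 0 ≤ t) (ht1 : t < 1) :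
    trunc x ≤ t ↔ x ≤ ENNReal.ofReal t := by
  unfold trunc
  constructor
  · intro h
    have h1 : min x 1 ≤ ENNReal.ofReal t := by
      rw [← ENNReal.ofReal_toReal (min_one_ne_top x)]; exact ENNReal.ofReal_le_ofReal h
    rcases le_total x 1 with hx | hx
    · rwa [min_eq_left hx] at h1
    · rw [min_eq_right hx] at h1
      exact absurd (lt_of_le_of_lt h1 (ENNReal.ofReal_lt_one.2 ht1)) (lt_irrefl _)
  · intro h
    have h1 : min x 1 ≤ ENNReal.ofReal t := le_trans (min_le_left _ _) h
    have := ENNReal.toReal_mono ENNReal.ofReal_ne_top h1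
    rwa [ENNReal.toReal_ofReal ht0] at this

/-- Below `1`, `trunc` is `toReal`. [folklore] -/
theorem trunc_eq_toReal_of_lt_one {x : ℝ≥0∞} (hx : x < 1) : trunc x = x.toReal := by
  unfold trunc; rw [min_eq_left hx.le]

/-- `toReal` of a sum of four finite `ℝ≥0∞`s is the sum of the `toReal`s. [folklore] -/
theorem toReal_add_four {a b c d : ℝ≥0∞} (hat : a ≠ ⊤) (hbt : b ≠ ⊤) (hct : c ≠ ⊤)
    (hdt : d ≠ ⊤) : (a + b + c + d).toReal = a.toReal + b.toReal + c.toReal + d.toReal := by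
  have hab : a + b ≠ ⊤ := ENNReal.add_ne_top.2 ⟨hat, hbt⟩
  have habc : a + b + c ≠ ⊤ := ENNReal.add_ne_top.2 ⟨hab, hct⟩
  rw [ENNReal.toReal_add habc hdt, ENNReal.toReal_add hab hct, ENNReal.toReal_add hat hbt]

/-- Sum version used for `𝔑^(Sup)`, `𝔑^(Dec)` (sums of four regional norms): for `0 ≤ t < 1`,
`trunc a + trunc b + trunc c + trunc d ≤ t ↔ a + b + c + d ≤ ENNReal.ofReal t`. [folklore] -/
theorem trunc_add_four_le_iff {a b c d : ℝ≥0∞} {t : ℝ} (ht0 : 0 ≤ t) (ht1 : t < 1) :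
    trunc a + trunc b + trunc c + trunc d ≤ t ↔ a + b + c + d ≤ ENNReal.ofReal t := by
  constructor
  · intro h
    have ha : trunc a < 1 := by linarith [trunc_nonneg b, trunc_nonneg c, trunc_nonneg d]
    have hb : trunc b < 1 := by linarith [trunc_nonneg a, trunc_nonneg c, trunc_nonneg d]
    have hc : trunc c < 1 := by linarith [trunc_nonneg a, trunc_nonneg b, trunc_nonneg d]
    have hd : trunc d < 1 := by linarith [trunc_nonneg a, trunc_nonneg b, trunc_nonneg c]
    have lt1 : ∀ {x : ℝ≥0∞}, trunc x < 1 → x < 1 := by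
      intro x hx
      by_contra hx'
      have : (1 : ℝ≥0∞) ≤ x := not_lt.mp hx'
      have := trunc_mono this
      have h1 : trunc 1 = 1 := by simp [trunc]
      rw [h1] at this
      exact absurd hx (not_lt.mpr this)
    have ha' := lt1 ha; have hb' := lt1 hb; have hc' := lt1 hc; have hd' := lt1 hd
    have hat : a ≠ ⊤ := ne_top_of_lt ha'
    have hbt : b ≠ ⊤ := ne_top_of_lt hb'
    have hct : c ≠ ⊤ := ne_top_of_lt hc'
    have hdt : d ≠ ⊤ := ne_top_of_lt hd'
    rw [trunc_eq_toReal_of_lt_one ha', trunc_eq_toReal_of_lt_one hb', trunc_eq_toReal_of_lt_one hc',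
      trunc_eq_toReal_of_lt_one hd'] at h
    have hsum := toReal_add_four hat hbt hct hdt
    have hfin : a + b + c + d ≠ ⊤ :=
      ENNReal.add_ne_top.2 ⟨ENNReal.add_ne_top.2 ⟨ENNReal.add_ne_top.2 ⟨hat, hbt⟩, hct⟩, hdt⟩
    rw [← ENNReal.ofReal_toReal hfin, hsum]
    exact ENNReal.ofReal_le_ofReal h
  · intro h
    have hlt : a + b + c + d < 1 := lt_of_le_of_lt h (ENNReal.ofReal_lt_one.2 ht1)
    have ha' : a < 1 := lt_of_le_of_lt (by exact le_add_right (le_add_right (le_add_right le_rfl))) hlt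
    have hb' : b < 1 := lt_of_le_of_lt (by exact le_add_right (le_add_right (le_add_left le_rfl))) hlt
    have hc' : c < 1 := lt_of_le_of_lt (by exact le_add_right (le_add_left le_rfl)) hlt
    have hd' : d < 1 := lt_of_le_of_lt (by exact le_add_left le_rfl) hlt
    have hat : a ≠ ⊤ := ne_top_of_lt ha'
    have hbt : b ≠ ⊤ := ne_top_of_lt hb'
    have hct : c ≠ ⊤ := ne_top_of_lt hc'
    have hdt : d ≠ ⊤ := ne_top_of_lt hd'
    rw [trunc_eq_toReal_of_lt_one ha', trunc_eq_toReal_of_lt_one hb', trunc_eq_toReal_of_lt_one hc',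
      trunc_eq_toReal_of_lt_one hd']
    have hsum := toReal_add_four hat hbt hct hdt
    have := ENNReal.toReal_mono ENNReal.ofReal_ne_top h
    rwa [ENNReal.toReal_ofReal ht0, hsum] at this

end SetupBridge

end Literature.Geometry.Lorentzian.KlainermanSzeftel2021.Bootstrap

end
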